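import Literature.MathematicalPhysics.QuantumFieldTheory.Balaban1983to89.B9Eq3105FamThreeLocDiffGAssembly
import Literature.MathematicalPhysics.QuantumFieldTheory.Balaban1983to89.B9Eq3105FamThreeLocResolvent
import Literature.MathematicalPhysics.QuantumFieldTheory.Balaban1983to89.B9Eq3105FamThreeLocCDiffChains

/-!
# `Balaban1983to89.B9Eq3105FamThreeLocCDiffWordsAt` — FAMILY 3 OF (3.105), THE LOCATED `C`-DIFFERENCE WORD `hP3` (D2), FILE F3-B3∕5: THE EIGHT SIGNED SITE
# WORDS OF `M_{χl}·G′_□(S − S_□)G′_□·M_{χl}` AT THE MEMBER CARRIER AND THEIR SUM — from DISPLAYED member-carrier majorants of the normalised letters (`η²G′_□(V′)`,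
# `η⁻⁴Q′*X⁻¹Q′(U₁)`, `η²G′(U₁)`, `R_χ(V′)`, `Q′*Q′`, `Q′*_□Q′_□`) and of the cube tails, and FILE 2's four-word identity as the hypothesis `h4`:
# `D_l·conj((M_{χl}·(B(S − S_□)B)·M_{χl})^ℝ)·D_r ≺ ε_{P3}·ℓ(a)⁻²·e^{−ρd}` with `ε_{P3}` EXPLICIT, every term carrying `e^{−a_sep(3M_h∕8 − 2)}` or `e^{−a_sep(3M_h∕8 − 1)}`
# (sub-row G-B9-LETTERS, GAPS G-B9-05 family 3 (D2); programme FAMTHREE; plan `lit-balaban-p33/g104/F3B3-KERNELS-PLAN.md` v2)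

statement-level skeleton of published theorems with citation tags; proofs where landed; nothing here is a claim about the Yang–Mills mass gap

THE PRINTED LOCUS (held `paper:balaban1985-cmp99-background-propagators`, journal page = PDF page + 388).  p. 415 l. 26–37 («Next we replace the operators G′_{□₀} and
C_{□₀} by G′_□, C_□, terms with the differences … are small by the same reason as before»); p. 412 l. 1–9 (the commutator mechanism) + l. 22–36 («an exponential factor
with a distance between localizations and a closest point where a change was made»); (3.95) p. 411; (3.48)–(3.49) pp. 398–399; (3.42) p. 397 (the `η`-units of `G′`);
(3.19)–(3.21) pp. 393–394, (3.25) pp. 394–395; p. 408 (`χ_□`, `S_j = M_h·L^{j+1}`).  [4] = `Balaban1984PropagatorsII`: (2.51)–(2.55) p. 232, Lemma 2.1 (2.60)–(2.61) p. 234,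
(2.83)–(2.85) pp. 237–238, (2.45)–(2.46) p. 231.  [2] = `Balaban1983RegularityDecay` (1.11)–(1.12): STATEMENT TYPE ONLY — the road below is OURS ([4]'s composition calculus
with one separated variable per word), not print's second random-walk expansion.

WHAT THIS FILE CERTIFIES (kernel-checked; 0 `def`, 0 `def … : Prop`, 0 sorry; standard axioms only)

* §1 (any ring ∕ any `ℂ`-algebra) ★ `siteWord_split` — p38's `sandwich_split` + a four-word identity `h4` for `M₂(S − S_□)M₂` give EIGHT signed words of
  `M_lB(S − S_□)BM_l`; ★ `norm_word1` … `norm_word4`, `norm_leak` — with `e·e·σ = 1` (`e = η²`, `σ = η⁻⁴`) every raw word EQUALS its `η`-normalised form (two `σ`, four `e`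
  in the core words; one `σ`, two `e` in the leaks) — the scalars of (3.42)∕(3.48) cost nothing.
* §2 ★ `collar_le_dist_chiL_notNear` — rows within one step of `supp χ_l`, columns off `NearC 3S_j`: `3M_h∕8 − 1 ≤ d` (p38 `collar_le_dist_of_nearC_of_not_nearC` BY NAME).
* §3 ★★★ `hasMajorant_word1_at` … `hasMajorant_word4_at`, ★★ `hasMajorant_leakA_at`, `hasMajorant_leakB_at` — the site operators
  `D_l·conj((M_lB·W_k·BM_l)^ℝ)·D_r` (`W₁ = M₂SP_□(1 − M_{χ_□})(BB)S_□M₂`, `W₂ = M₂S(AA)(1 − M_{χ_□})PS_□M₂`, `W₃ = M₂S(AA)R_χS_□M₂`, `W₄ = M₂SAR_χBS_□M₂`, leaks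
  `M₂X(1 − M₂)`, `(1 − M₂)X`) with the cut-offs `M_l = M_{χl_□}`, `M₂ = M_{𝟙[NearC 3S_j]}` and `R_χ(V′) = (M_{χ_□}Δ′_□(V′) − Δ′_□(V′)M_{χ_□})G′_□(V′)` CONCRETE (rows of `R_χ` in
  the annulus: F3-E2b `mulOp_transInd_mul_conj_commStep`; collars: p38 `collar_le_dist_chiL_chiY` ∕ `_annulus`, §2) and the other letters ABSTRACT `ℂ`-linear operators with
  DISPLAYED member-carrier majorants of the shapes the suppliers give (`D_lM_lB` located in `S_L`-blocks with weight `ℓ`, `S`: `ℓ⁻⁴`, `A`: `ℓ²`, `R_χ`: `1`, `P`, `P_□`: block-local,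
  tails `(B^k)S_□M₂·BM_lD_r`: `ℓ⁻³`, `ℓ⁻¹`, `ℓ`, `M₂X`: `ℓ⁻⁴`, `X·BM_lD_r`: `ℓ⁻³`, `BM_lD_r`: `ℓ`) — by FILE 4's abstract words `word1_majorant_blk` … `leak_majorant_blk`,
  `word_far_majorant_blk` BY NAME, after `conj` is distributed over the word (r06 `conj_mul`, `conj_cutMulY`).
* §4 ★★★ `hasMajorant_siteWord_of_letters` — THE SUM: `D_l·conj((M_l·(B(S − S_□)B)·M_l)^ℝ)·D_r ≺ ε_{P3}·ℓ(a)⁻²·e^{−(r₀ − 5ε − a_sep)d}`, `ε = (α + β)δ₀`,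
  `ε_{P3} = K₁ + ⋯ + K₈` written out (products of the displayed constants, scale-transfer constants, `c₁(δ₀,β)`-powers and ONE collar factor each).

ROAD (ours).  FILE 7 (assembly at the record) instantiates: `B := G′_□(V′)`, `S := Q′*X⁻¹Q′(U₁)`, `S_□`, `A := G′(U₁)`, `P := Q′*Q′(U₁)`, `P_□ := Q′*_□Q′_□(V′)`, `e := η²`, `σ := s`
(`η²η²s = 1`, the record's `hs`), `h4 := B9Eq3105FamThreeLocCDiffSplit.cut_locCDiff_cut_eq_fourWords` (FILE 2), `D_l, D_r := conj(η⁻¹∇_μ), conj(η⁻¹∇*_ν)`, and the bond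
relabel (`B9Cor36DPDsCubeAtLocCfg.hasMajorant_conj_gradMdiv_of_relabel`, `B9Eq376DerivDict.hasMajorant_gradLin_comp_comp_divLin`) to reach the record's `hP3 □`; FILE 6 supplies
the displayed letter ∕ tail majorants (`hCinv` + atoms A1 → `S`; `hE` → `A`; F3-E2b∕E2e + `hR` → `R_χ`; atoms + `hasMajorant_diag_coarsen` → `P`, `P_□`; cube data at `Ṽ_□`
(r05∕p33 `gp_cube_at_locCfg`, p21 `cinv_cube_at_locCfg`) + rotations + p38's sandwich transfers → `B`, tails, `D_lM_lB`, `BM_lD_r` via (3.100)).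

HONEST SCOPE ∕ NOT CLAIMED.  Finite lattice algebra and [4]'s (2.51)–(2.61)∕(2.83) bookkeeping over landed modules; NO inequality of [B9] is proved here (every letter ∕
tail majorant and the identity `h4` are HYPOTHESES with named suppliers).  Count-neutral; NOT a node discharge; `hP3` NOT yet discharged; nothing continuum ∕ OS ∕ mass-gap ∕
Clay; YM mass gap NOT proved (Track A conditional rung).  No `sorry`, no `axiom`, no `… : Prop` fact, no `instance`, no `notation`, no `def`.  NEW file; nothing landed is
modified.  Cell `lit-balaban`, seat `lit-balaban-p33` gen 104, 2026-08-29; `--supports stmt-QuantumFields-19200` as helper.  Net new unproved facts: 0.  Inhabited: all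
operators `0`, all constants `0` satisfy every hypothesis (`h4`: `0 = 0`) and the conclusion (`0 ≺ 0`); not a vacuous schema.

RELATED IN THE TREE, NOT DUPLICATED (searched 2026-08-29: `rg 'siteWord_split|norm_word|hasMajorant_word[1-4]_at|hasMajorant_leak[AB]_at|siteWord_of_letters' Literature/` = ∅):
FILE 2 `B9Eq3105FamThreeLocCDiffSplit` (the identity `h4` at the pair), FILE 3 `…Atoms`, FILE 4 `…Chains` (abstract words — USED BY NAME), p38 `B9Eq3105FamThreeLocResolvent.sandwich_split`,
p33 `B9Eq3105FamThreeLocDiffGAssembly` (the `hDL` twin: `hasMajorant_hDL_chiL`; its cut-off lemmas `abs_one_sub_chiY_le_one` … USED BY NAME), F3-E2b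
`B9Eq3105FamThreeCommStepMember` (`mulOp_transInd_mul_conj_commStep`, `transIndSite_mem`), p38 `B9Cor36CollarSeparation`, r06 `B9Eq352DivFormLetters.conj_mul` ∕
`B9Thm39CinvTorusRegular.conj_cutMulY`, pv08∕r06 `B6RandomWalk`, `B6DomainMajorant.hasMajorant_sub`.
-/

noncomputable section




namespace Literature.MathematicalPhysics.QuantumFieldTheory.Balaban1983to89.B9Eq3105FamThreeLocCDiffWordsAt

open B6RandomWalk (HasMajorant hasMajorant_mono hasMajorant_add hasMajorant_mul Ineq261 c1_nonneg Triangle254)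
open B6RandomWalkHom (HasMajorantHom hasMajorantHom_iff hasMajorantHom_mono)
open B9Thm34Ext (toB6)
open B9Thm37Sum (mulOp mulOp_apply)
open B9Ineq347 (ScaleTransfer)
open B9Ineq366CPrime (scaleTransfer_one)
open B9Ineq368PPrime (scaleTransfer_mul scaleTransfer_exp_mono)
open B9Ineq349Hom (hasMajorantHom_rate_mono)
open B9Eq395Small (hasMajorant_mulOp_left hasMajorant_mul_mulOp_right)
open B9Thm39CinvSepMiddle (hasMajorant_mulOp_rows)
open B9Thm39CinvTorusRegular (conj_cutMulY)
open B9Eq3105FamThreeTFar (rowSep_majorant_blk)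
open B9Eq3105FamThreeLocResolvent (sandwich_split)
open B9Eq3105FamThreeLocCDiffChains (chain_majorant_blk chain_local_majorant_blk mul_decay_majorant_blk mul_local_majorant_blk word_far_majorant_blk
  hasMajorant_diag_coarsen word1_majorant_blk word2_majorant_blk word3_majorant_blk word4_majorant_blk leak_majorant_blk)
open B9Eq352DivFormLetters (conj)
open B9Eq352GradLetters (diffLetter)
open B6KLevelCensusIndexV1 (KIdx kGeo)
open B6Cover236MultiLevelBlocks (cubes)
open B6GlobalChartV1 (PV boxEquiv)
open B6Geom246MultiLevelBox (blkOf)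
open B6Ineq2142KLevelV1 (β)
open B9GeoNormsKLevelV1 (geo9K)
open B9CubeLettersOpsL0 (deltaPrimeACubeY GpCubeY)
open B9CubeLettersBondOpsL0 (QpCubeY QpsCubeY XCubeY XinvCubeY)
open B9Thm37CubeCoverCommutators (cutMulY cutMulY_apply cutMulY_mul)
open B9Cor36CutoffField337 (bumpY abs_bumpY_le_one bumpY_nonneg bumpY_le_one)
open B9Cor36CubeCutoffs (SC NearC chiY ctrR locCfgY one_le_SC chiY_eq_one_of_nearC abs_chiY_le_one)
open B9Cor36CubeTwinsGeometry (bS)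
open B9GeoLemma21KLevelV1 (one_le_Mh geo9K_len_pos)
open B9Cor36CollarSeparation (nearC_of_chiL_ne_zero chiL_mul_chiY collar_le_dist_chiL_chiY collar_le_dist_chiL_annulus collar_le_dist_of_nearC_of_not_nearC
  not_nearC_of_chiY_ne_one)
open B9Cor36SiteSandwichTransfer (geo9K_len_site)
open B9Eq3105FamTwoCore (geo9K_axioms)
open B9Eq3105FamThreeLocDiffGAssembly (abs_chiL_le_one nearC_of_chiL_shiftY_ne_zero abs_one_sub_chiY_le_one)
open B9Eq3105FamThreeCommStepMember (mulOp_transInd_mul_conj_commStep transIndSite_mem)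
open Node00 (SiteY BlkY IBondY CfgY GaugeY toKT shiftY UboxY GpY QpY QpsY XinvY deltaPrimeAY gaugeY parSymY etaS levY)

/-! ## §1  Ring algebra: the eight signed words of `M_l·B·(S − S_□)·B·M_l`, and their `η`-normalisation -/

section Ring

variable {𝓡 : Type} [Ring 𝓡]

/-- ★ **THE EIGHT WORDS**: p38's `sandwich_split` (insertion of `M₂` on both inner sides) followed by FILE 2's four-word form of the core `M₂(S − S_□)M₂ = W₁ − W₂ − W₃ − W₄`:
`M_lB(S − S_□)BM_l = Σ± M_lB·W_k·BM_l + M_lB·M₂S(1 − M₂)·BM_l − M_lB·M₂S_□(1 − M₂)·BM_l + M_lB·(1 − M₂)S·BM_l − M_lB·(1 − M₂)S_□·BM_l`.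
[cite: Balaban1985BackgroundPropagators, p.415 l.26–37, p.412 l.22–36; algebra ours] -/
theorem siteWord_split (Ml B S Sb M₂ W₁ W₂ W₃ W₄ : 𝓡) (h4 : M₂ * (S - Sb) * M₂ = W₁ - W₂ - W₃ - W₄) :
    Ml * (B * (S - Sb) * B) * Ml =
      Ml * B * W₁ * B * Ml - Ml * B * W₂ * B * Ml - Ml * B * W₃ * B * Ml - Ml * B * W₄ * B * Ml +
        Ml * B * (M₂ * S * (1 - M₂)) * B * Ml - Ml * B * (M₂ * Sb * (1 - M₂)) * B * Ml +
        Ml * B * ((1 - M₂) * S) * B * Ml - Ml * B * ((1 - M₂) * Sb) * B * Ml := by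
  rw [sandwich_split B S Sb M₂, h4]
  noncomm_ring

end Ring

section Algebra

variable {𝓐 : Type} [Ring 𝓐] [Algebra ℂ 𝓐]

/-- ★ **`η`-NORMALISATION OF WORD 3** (`e = η²`, `σ = s = η⁻⁴`, `e·e·σ = 1`): the raw letters `G′_□, Q′*X⁻¹Q′, G′, G′, R_χ, Q′*_□X_□⁻¹Q′_□, G′_□` carry the same
operator as the normalised ones `η²G′_□, s·Q′*X⁻¹Q′, η²G′, η²G′, R_χ, s·(…)_□, η²G′_□` (two `s`, four `η²`). [cite: Balaban1985BackgroundPropagators, (3.42) p.397, (3.48) p.398, (3.95) p.411; bookkeeping] -/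
theorem norm_word3 {e σ : ℂ} (hσ : e * e * σ = 1) (Ml B M₂ S A R Sb : 𝓐) :
    Ml * B * (M₂ * S * (A * A) * R * Sb * M₂) * B * Ml =
      Ml * (e • B) * (M₂ * (σ • S) * ((e • A) * (e • A)) * R * (σ • Sb) * M₂) * (e • B) * Ml := by
  symm
  simp only [smul_mul_assoc, mul_smul_comm, smul_smul]
  exact (congrArg (· • _) (by linear_combination (e * e * σ + 1) * hσ)).trans (one_smul ℂ _)

/-- `η`-normalisation of WORD 1 (two `s`, four `η²`). [cite: Balaban1985BackgroundPropagators, (3.42) p.397, (3.48) p.398; bookkeeping] -/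
theorem norm_word1 {e σ : ℂ} (hσ : e * e * σ = 1) (Ml B M₂ S Pb F Sb : 𝓐) :
    Ml * B * (M₂ * S * Pb * F * (B * B) * Sb * M₂) * B * Ml =
      Ml * (e • B) * (M₂ * (σ • S) * Pb * F * ((e • B) * (e • B)) * (σ • Sb) * M₂) * (e • B) * Ml := by
  symm
  simp only [smul_mul_assoc, mul_smul_comm, smul_smul]
  exact (congrArg (· • _) (by linear_combination (e * e * σ + 1) * hσ)).trans (one_smul ℂ _)

/-- `η`-normalisation of WORD 2 (two `s`, four `η²`). [cite: Balaban1985BackgroundPropagators, (3.42) p.397, (3.48) p.398; bookkeeping] -/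
theorem norm_word2 {e σ : ℂ} (hσ : e * e * σ = 1) (Ml B M₂ S A F P Sb : 𝓐) :
    Ml * B * (M₂ * S * (A * A) * F * P * Sb * M₂) * B * Ml =
      Ml * (e • B) * (M₂ * (σ • S) * ((e • A) * (e • A)) * F * P * (σ • Sb) * M₂) * (e • B) * Ml := by
  symm
  simp only [smul_mul_assoc, mul_smul_comm, smul_smul]
  exact (congrArg (· • _) (by linear_combination (e * e * σ + 1) * hσ)).trans (one_smul ℂ _)

/-- `η`-normalisation of WORD 4 (two `s`, four `η²`). [cite: Balaban1985BackgroundPropagators, (3.42) p.397, (3.48) p.398; bookkeeping] -/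
theorem norm_word4 {e σ : ℂ} (hσ : e * e * σ = 1) (Ml B M₂ S A R Sb : 𝓐) :
    Ml * B * (M₂ * S * A * R * B * Sb * M₂) * B * Ml =
      Ml * (e • B) * (M₂ * (σ • S) * (e • A) * R * (e • B) * (σ • Sb) * M₂) * (e • B) * Ml := by
  symm
  simp only [smul_mul_assoc, mul_smul_comm, smul_smul]
  exact (congrArg (· • _) (by linear_combination (e * e * σ + 1) * hσ)).trans (one_smul ℂ _)

/-- `η`-normalisation of a LEAK (one `s`, two `η²`): `M_lB·(M₂X(1 − M₂))·BM_l` and `M_lB·((1 − M₂)X)·BM_l`, `X = S` or `S_□`.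
[cite: Balaban1985BackgroundPropagators, (3.42) p.397, (3.48) p.398; bookkeeping] -/
theorem norm_leak {e σ : ℂ} (hσ : e * e * σ = 1) (Ml B M₂ X : 𝓐) :
    Ml * B * (M₂ * X * (1 - M₂)) * B * Ml = Ml * (e • B) * (M₂ * (σ • X) * (1 - M₂)) * (e • B) * Ml ∧
      Ml * B * ((1 - M₂) * X) * B * Ml = Ml * (e • B) * ((1 - M₂) * (σ • X)) * (e • B) * Ml := by
  refine ⟨?_, ?_⟩
  · symm
    simp only [smul_mul_assoc, mul_smul_comm, smul_smul]
    exact (congrArg (· • _) (by linear_combination hσ)).trans (one_smul ℂ _)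
  · symm
    simp only [smul_mul_assoc, mul_smul_comm, smul_smul]
    exact (congrArg (· • _) (by linear_combination hσ)).trans (one_smul ℂ _)

end Algebra


/-! ## §2  The located rows, the far sets and their collars (p38 `B9Cor36CollarSeparation` BY NAME) -/

section Sets

variable {d ℓ : ℕ} {hd : 1 ≤ d + 1} {hL : Odd (ℓ + 1) ∧ 1 < ℓ + 1} {b₀ b₁ : ℝ}
variable (i : KIdx d ℓ hd hL b₀ b₁) (c : ↥(cubes (toKT i).D.toDomains))

/-- ★ **THE LEAKS' COLLAR**: rows within one step of `supp χ_l` (`NearC(21S_j∕8 + 1)`), columns off `NearC 3S_j` (where `1 − M₂ ≠ 0`): `3M_h∕8 − 1 ≤ d`.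
[cite: Balaban1985BackgroundPropagators, p.412 l.22–36, p.415 l.26–37; Balaban1984PropagatorsII, (2.46) p.231, (2.83) p.237] -/
theorem collar_le_dist_chiL_notNear (ιB : BlkY i → IBondY i) (hι : ∀ s, β i.hN i.D i.hk (ιB s) = s) {z w : SiteY i}
    (hz : NearC i c (21 * SC i c / 8 + 1) z.1) (hw : ¬ NearC i c (3 * SC i c) w.1) :
    3 / 8 * (i.Mh : ℝ) - 1 ≤ (geo9K i).dist (ιB (blkOf i.D.toDomains z)) (ιB (blkOf i.D.toDomains w)) := by
  have key := collar_le_dist_of_nearC_of_not_nearC i c ιB hι le_rfl hz hw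
  have hS1 := one_le_SC i c
  have hS : (0 : ℝ) < (SC i c : ℝ) := by exact_mod_cast (show (0 : ℤ) < SC i c by omega)
  have hMh : (0 : ℝ) ≤ (i.Mh : ℝ) := by positivity
  have hgap : 3 * (SC i c : ℝ) ≤ 8 * (((3 * SC i c + 1 - (21 * SC i c / 8 + 1) : ℤ) : ℝ)) := by
    have h8 : 8 * (21 * SC i c / 8) ≤ 21 * SC i c := Int.mul_ediv_self_le (by norm_num)
    have : 3 * SC i c ≤ 8 * (3 * SC i c + 1 - (21 * SC i c / 8 + 1)) := by omega
    have h' : ((3 * SC i c : ℤ) : ℝ) ≤ ((8 * (3 * SC i c + 1 - (21 * SC i c / 8 + 1)) : ℤ) : ℝ) := Int.cast_le.mpr this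
    have e1 : ((3 * SC i c : ℤ) : ℝ) = 3 * (SC i c : ℝ) := by push_cast; ring
    have e2 : ((8 * (3 * SC i c + 1 - (21 * SC i c / 8 + 1)) : ℤ) : ℝ) = 8 * (((3 * SC i c + 1 - (21 * SC i c / 8 + 1) : ℤ) : ℝ)) := by
      push_cast; ring
    rw [e1, e2] at h'
    exact h'
  have hmono : 3 / 8 * (i.Mh : ℝ) ≤ (i.Mh : ℝ) * (((3 * SC i c + 1 - (21 * SC i c / 8 + 1) : ℤ) : ℝ)) / (SC i c : ℝ) := by
    rw [le_div_iff₀ hS]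
    nlinarith
  linarith

end Sets

/-! ## §3  The words at the site carrier `(toB6 (geo9K i) Rr′ Hp, ι_B∘Δ)`: cut-offs and `R_χ` concrete, the other letters abstract -/

section Words

variable {d ℓ : ℕ} {hd : 1 ≤ d + 1} {hL : Odd (ℓ + 1) ∧ 1 < ℓ + 1} {b₀ b₁ : ℝ}
variable {𝔸 : Type} [NormedRing 𝔸] [NormedAlgebra ℂ 𝔸] [CompleteSpace 𝔸]
variable {ι : Type} [Fintype ι]
variable (i : KIdx d ℓ hd hL b₀ b₁) (c : ↥(cubes (toKT i).D.toDomains)) (b : Module.Basis ι ℝ 𝔸)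
variable [Fintype (geo9K i).Site] [DecidableEq (geo9K i).Site] {Rr' : ℝ} {Hp : Prop}

omit [CompleteSpace 𝔸] [Fintype ι] [Fintype (geo9K i).Site] [DecidableEq (geo9K i).Site] in
/-- `1 − M_χ = M_{1−χ}`. [cite: Balaban1985BackgroundPropagators, p.408, bookkeeping] -/
theorem one_sub_cutMulY (χ : SiteY i → ℝ) :
    (1 - cutMulY (𝔸 := 𝔸) χ : (SiteY i → 𝔸) →ₗ[ℂ] (SiteY i → 𝔸)) = cutMulY (𝔸 := 𝔸) (fun z => 1 - χ z) := by
  refine LinearMap.ext fun Λ => funext fun z => ?_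
  rw [LinearMap.sub_apply, Pi.sub_apply, Module.End.one_apply, cutMulY_apply, cutMulY_apply, Complex.ofReal_sub, Complex.ofReal_one, sub_smul, one_smul]

/-- a right multiplier bounded by `1` does not enlarge a nonnegative majorant. [cite: Balaban1984PropagatorsII, (2.51)–(2.52) p.232, bookkeeping] -/
theorem hasMajorant_mul_mulOp_le {X : Type} (blk : X → (geo9K i).Site) {T : Module.End ℝ (X → ℝ)} {K : (geo9K i).Site → (geo9K i).Site → ℝ}
    (hT : HasMajorant (g := toB6 (geo9K i) Rr' Hp) blk T K) (h : X → ℝ) (hh : ∀ x, |h x| ≤ 1) :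
    HasMajorant (g := toB6 (geo9K i) Rr' Hp) blk (T * mulOp h) K := by
  classical
  refine hasMajorant_mono (g := toB6 (geo9K i) Rr' Hp) _ (hasMajorant_mul_mulOp_right (R := Rr') (H := Hp) blk hT h hh Finset.univ fun x _ => Finset.mem_univ _)
    fun a a' => ?_
  rw [if_pos (Finset.mem_univ _), one_mul]

open Classical in
set_option maxHeartbeats 1600000 in
/-- ★★★ **WORD 3 AT THE SITE CARRIER** — `D_l·conj((M_lB·(M₂S(AA)R_χS_□M₂)·BM_l)^ℝ)·D_r` with `M_l = M_{χl_□}`, `M₂ = M_{𝟙[NearC 3S_j]}`,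
`R_χ = (M_{χ_□}Δ′_□(V′) − Δ′_□(V′)M_{χ_□})G′_□(V′)` (rows in the annulus `¬NearC(3S_j − b_j)`, F3-E2b `mulOp_transInd_mul_conj_commStep`), the other letters ABSTRACT with displayed
majorants (`D_lM_lB` located in `NearC(21S_j∕8 + 1)` with weight `ℓ`, `S` weight `ℓ⁻⁴`, `A` weight `ℓ²`, `R_χ` weight `1`, the tail `S_□M₂BM_lD_r` weight `ℓ⁻³`); separation
`3M_h∕8 − 2` (p38 `collar_le_dist_chiL_annulus`):
`≺ 𝟙[a ∈ S_L]·(κ_Lκ_Sκ_A²θκ_T·C_SC_A²C_T·c₁⁵·e^{−a_sep(3M_h∕8 − 2)})·(ℓℓ⁻⁴(ℓ²)²ℓ⁻³)(a)·e^{−(r₀ − 5ε − a_sep)d}`.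
[cite: Balaban1985BackgroundPropagators, p.412 l.1–9 + l.22–36, p.415 l.29–37, (3.48)–(3.49) pp.398–399; Balaban1984PropagatorsII, (2.83)–(2.85) pp.237–238, (2.52)–(2.55) p.232, (2.60)–(2.61) p.234] -/
theorem hasMajorant_word3_at (ιB : BlkY i → IBondY i) (hι : ∀ s, β i.hN i.D i.hk (ιB s) = s) (V' : CfgY 𝔸 i)
    (S_L : Finset (geo9K i).Site) (hSL : ∀ a ∈ S_L, ∃ z : SiteY i, ιB (blkOf i.D.toDomains z) = a ∧ NearC i c (21 * SC i c / 8 + 1) z.1)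
    (Dl Dr : Module.End ℝ (SiteY i × ι → ℝ)) (B S A Sb : Module.End ℂ (SiteY i → 𝔸))
    (dB : ℕ) {κL κS κA θ κT r₀ rS rA rc rT δ₀ α β asep CS CA CT : ℝ}
    (hκL : 0 ≤ κL) (hκS : 0 ≤ κS) (hκA : 0 ≤ κA) (hθ : 0 ≤ θ) (hκT : 0 ≤ κT) (hCS : 0 ≤ CS) (hCA : 0 ≤ CA) (hCT : 0 ≤ CT)
    (hαδ : 0 ≤ α * δ₀) (hε0 : 0 ≤ (α + β) * δ₀) (hasep : 0 ≤ asep) (hρ : 0 ≤ r₀ - 5 * ((α + β) * δ₀) - asep)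
    (hrS : r₀ - (α + β) * δ₀ ≤ rS) (hrA : r₀ - 2 * ((α + β) * δ₀) ≤ rA) (hrc : r₀ - 4 * ((α + β) * δ₀) - asep ≤ rc)
    (hrT : r₀ - 5 * ((α + β) * δ₀) - asep ≤ rT)
    (hSTS : ScaleTransfer (geo9K i) δ₀ α CS (fun a => ((geo9K i).len a ^ 4)⁻¹)) (hSTA : ScaleTransfer (geo9K i) δ₀ α CA (fun a => (geo9K i).len a ^ 2))
    (hSTT : ScaleTransfer (geo9K i) δ₀ α CT (fun a => ((geo9K i).len a ^ 3)⁻¹)) (h261 : Ineq261 dB (toB6 (geo9K i) Rr' Hp) δ₀ β)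
    (hL : HasMajorant (g := toB6 (geo9K i) Rr' Hp) (fun p : SiteY i × ι => ιB (blkOf i.D.toDomains p.1))
      (Dl * mulOp (fun p : SiteY i × ι => bumpY i (ctrR i c) (3 * (SC i c : ℝ)) p.1) * conj b (B.restrictScalars ℝ))
      (fun a a' : (geo9K i).Site => (if a ∈ S_L then (1 : ℝ) else 0) * (κL * (geo9K i).len a * Real.exp (-(r₀ * (geo9K i).dist a a')))))
    (hS : HasMajorant (g := toB6 (geo9K i) Rr' Hp) (fun p : SiteY i × ι => ιB (blkOf i.D.toDomains p.1)) (conj b (S.restrictScalars ℝ))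
      (fun a a' => κS * ((geo9K i).len a ^ 4)⁻¹ * Real.exp (-(rS * (geo9K i).dist a a'))))
    (hA : HasMajorant (g := toB6 (geo9K i) Rr' Hp) (fun p : SiteY i × ι => ιB (blkOf i.D.toDomains p.1)) (conj b (A.restrictScalars ℝ))
      (fun a a' => κA * (geo9K i).len a ^ 2 * Real.exp (-(rA * (geo9K i).dist a a'))))
    (hRc : HasMajorant (g := toB6 (geo9K i) Rr' Hp) (fun p : SiteY i × ι => ιB (blkOf i.D.toDomains p.1))
      (conj b (((cutMulY (𝔸 := 𝔸) (chiY i c) * deltaPrimeACubeY i c (parSymY i) V' - deltaPrimeACubeY i c (parSymY i) V' * cutMulY (𝔸 := 𝔸) (chiY i c)) *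
        GpCubeY i c (parSymY i) V').restrictScalars ℝ))
      (fun a a' => θ * Real.exp (-(rc * (geo9K i).dist a a'))))
    (hTail : HasMajorant (g := toB6 (geo9K i) Rr' Hp) (fun p : SiteY i × ι => ιB (blkOf i.D.toDomains p.1))
      (conj b (Sb.restrictScalars ℝ) * mulOp (fun p : SiteY i × ι => if NearC i c (3 * SC i c) p.1.1 then (1 : ℝ) else 0) *
        (conj b (B.restrictScalars ℝ) * mulOp (fun p : SiteY i × ι => bumpY i (ctrR i c) (3 * (SC i c : ℝ)) p.1) * Dr))
      (fun a a' => κT * ((geo9K i).len a ^ 3)⁻¹ * Real.exp (-(rT * (geo9K i).dist a a')))) :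
    HasMajorant (g := toB6 (geo9K i) Rr' Hp) (fun p : SiteY i × ι => ιB (blkOf i.D.toDomains p.1))
      (Dl * conj b ((cutMulY (𝔸 := 𝔸) (bumpY i (ctrR i c) (3 * (SC i c : ℝ))) * B *
          (cutMulY (𝔸 := 𝔸) (fun z : SiteY i => if NearC i c (3 * SC i c) z.1 then (1 : ℝ) else 0) * S * (A * A) *
            ((cutMulY (𝔸 := 𝔸) (chiY i c) * deltaPrimeACubeY i c (parSymY i) V' - deltaPrimeACubeY i c (parSymY i) V' * cutMulY (𝔸 := 𝔸) (chiY i c)) *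
              GpCubeY i c (parSymY i) V') * Sb *
            cutMulY (𝔸 := 𝔸) (fun z : SiteY i => if NearC i c (3 * SC i c) z.1 then (1 : ℝ) else 0)) * B *
          cutMulY (𝔸 := 𝔸) (bumpY i (ctrR i c) (3 * (SC i c : ℝ)))).restrictScalars ℝ) * Dr)
      (fun a a' : (geo9K i).Site => (if a ∈ S_L then (1 : ℝ) else 0) *
        ((κL * κS * κA ^ 2 * θ * κT * (CS * CA ^ 2 * CT) * B6.c1 dB δ₀ β ^ 5 * Real.exp (-(asep * (3 / 8 * (i.Mh : ℝ) - 2)))) *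
          ((geo9K i).len a * ((geo9K i).len a ^ 4)⁻¹ * ((geo9K i).len a ^ 2) ^ 2 * ((geo9K i).len a ^ 3)⁻¹) *
            Real.exp (-((r₀ - 5 * ((α + β) * δ₀) - asep) * (geo9K i).dist a a')))) := by
  obtain ⟨htri, -, hdnn⟩ := geo9K_axioms i Rr' Hp
  set χl : SiteY i → ℝ := bumpY i (ctrR i c) (3 * (SC i c : ℝ)) with hχl
  set ind : SiteY i → ℝ := fun z => if NearC i c (3 * SC i c) z.1 then (1 : ℝ) else 0 with hind
  set Rχ : Module.End ℂ (SiteY i → 𝔸) :=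
    (cutMulY (𝔸 := 𝔸) (chiY i c) * deltaPrimeACubeY i c (parSymY i) V' - deltaPrimeACubeY i c (parSymY i) V' * cutMulY (𝔸 := 𝔸) (chiY i c)) *
      GpCubeY i c (parSymY i) V' with hRχ
  -- the word in coordinates: `conj` is multiplicative, cut-offs become multipliers
  have e1 : ((cutMulY (𝔸 := 𝔸) χl * B * (cutMulY (𝔸 := 𝔸) ind * S * (A * A) * Rχ * Sb * cutMulY (𝔸 := 𝔸) ind) * B * cutMulY (𝔸 := 𝔸) χl).restrictScalars ℝ
        : Module.End ℝ (SiteY i → 𝔸)) =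
      (cutMulY (𝔸 := 𝔸) χl).restrictScalars ℝ * B.restrictScalars ℝ *
        ((cutMulY (𝔸 := 𝔸) ind).restrictScalars ℝ * S.restrictScalars ℝ * (A.restrictScalars ℝ * A.restrictScalars ℝ) * Rχ.restrictScalars ℝ *
          Sb.restrictScalars ℝ * (cutMulY (𝔸 := 𝔸) ind).restrictScalars ℝ) * B.restrictScalars ℝ * (cutMulY (𝔸 := 𝔸) χl).restrictScalars ℝ :=
    LinearMap.ext fun _ => rfl
  rw [e1]
  simp only [B9Eq352DivFormLetters.conj_mul, conj_cutMulY]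
  rw [show Dl * (mulOp (fun p : SiteY i × ι => χl p.1) * conj b (B.restrictScalars ℝ) *
        (mulOp (fun p : SiteY i × ι => ind p.1) * conj b (S.restrictScalars ℝ) * (conj b (A.restrictScalars ℝ) * conj b (A.restrictScalars ℝ)) *
          conj b (Rχ.restrictScalars ℝ) * conj b (Sb.restrictScalars ℝ) * mulOp (fun p : SiteY i × ι => ind p.1)) *
        conj b (B.restrictScalars ℝ) * mulOp (fun p : SiteY i × ι => χl p.1)) * Dr =
      (Dl * mulOp (fun p : SiteY i × ι => χl p.1) * conj b (B.restrictScalars ℝ) * mulOp (fun p : SiteY i × ι => ind p.1)) *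
        conj b (S.restrictScalars ℝ) * conj b (A.restrictScalars ℝ) * conj b (A.restrictScalars ℝ) * conj b (Rχ.restrictScalars ℝ) *
        (conj b (Sb.restrictScalars ℝ) * mulOp (fun p : SiteY i × ι => ind p.1) *
          (conj b (B.restrictScalars ℝ) * mulOp (fun p : SiteY i × ι => χl p.1) * Dr)) from by simp only [mul_assoc]]
  -- the located prefix through the near cut-off `M₂`
  have hL' := hasMajorant_mul_mulOp_le i (Rr' := Rr') (Hp := Hp) _ hL (fun p : SiteY i × ι => ind p.1) fun p => by
    simp only [hind]; split_ifs <;> simp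
  -- the separation and the row cut of `R_χ`
  have hsep : ∀ a ∈ S_L,
      ∀ y ∈ (Finset.univ.filter fun a : IBondY i => ∃ z : SiteY i, ιB (blkOf i.D.toDomains z) = a ∧ ¬ NearC i c (3 * SC i c - (bS i c : ℤ)) z.1),
        3 / 8 * (i.Mh : ℝ) - 2 ≤ (geo9K i).dist a y := fun a ha y hy => by
    obtain ⟨z, rfl, hz⟩ := hSL a ha
    obtain ⟨w, rfl, hw⟩ := (Finset.mem_filter.1 hy).2
    exact collar_le_dist_chiL_annulus i c ιB hι hz hw
  have hw1 : ∀ a : IBondY i, 0 ≤ (geo9K i).len a := fun a => (geo9K_len_pos i a).le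
  have h := word3_majorant_blk (Rg := Rr') (Hg := Hp) (fun p : SiteY i × ι => ιB (blkOf i.D.toDomains p.1)) dB S_L
    ((Finset.univ.filter fun a : IBondY i => ∃ z : SiteY i, ιB (blkOf i.D.toDomains z) = a ∧ ¬ NearC i c (3 * SC i c - (bS i c : ℤ)) z.1 :) :
      Finset (IBondY i))
    (fun p : SiteY i × ι => if NearC i c (3 * SC i c - (bS i c : ℤ)) p.1.1 then (0 : ℝ) else 1)
    (fun a => (geo9K i).len a) (fun a => ((geo9K i).len a ^ 4)⁻¹) (fun a => (geo9K i).len a ^ 2) (fun a => ((geo9K i).len a ^ 3)⁻¹)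
    hκL hκS hκA hθ hκT hCS hCA hCT hw1 (fun a => by have := hw1 a; positivity) (fun a => by positivity) (fun a => by have := hw1 a; positivity)
    hαδ hε0 hasep hρ hrS hrA hrc hrT hdnn htri hSTS hSTA hSTT h261 (fun p => by split_ifs <;> simp)
    (fun p hp => by by_contra h; exact hp (transIndSite_mem i c ιB p h)) (mulOp_transInd_mul_conj_commStep i c b (parSymY i) V') hsep hL' hS hA hRc hTail
  exact h

open Classical in
set_option maxHeartbeats 1600000 in
/-- ★★★ **WORD 4 AT THE SITE CARRIER** — `D_l·conj((M_lB·(M₂SAR_χBS_□M₂)·BM_l)^ℝ)·D_r`, the tail with one cube propagator `B·S_□M₂·BM_lD_r` (weight `ℓ⁻¹`) displayed: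
`≺ 𝟙[a ∈ S_L]·(κ_Lκ_Sκ_Aθκ_T·C_SC_AC_T·c₁⁴·e^{−a_sep(3M_h∕8 − 2)})·(ℓℓ⁻⁴ℓ²ℓ⁻¹)(a)·e^{−(r₀ − 4ε − a_sep)d}`.
[cite: Balaban1985BackgroundPropagators, p.412 l.1–9 + l.22–36, p.415 l.29–37, (3.48)–(3.49) pp.398–399; Balaban1984PropagatorsII, (2.83)–(2.85) pp.237–238, (2.52)–(2.55) p.232, (2.60)–(2.61) p.234] -/
theorem hasMajorant_word4_at (ιB : BlkY i → IBondY i) (hι : ∀ s, β i.hN i.D i.hk (ιB s) = s) (V' : CfgY 𝔸 i)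
    (S_L : Finset (geo9K i).Site) (hSL : ∀ a ∈ S_L, ∃ z : SiteY i, ιB (blkOf i.D.toDomains z) = a ∧ NearC i c (21 * SC i c / 8 + 1) z.1)
    (Dl Dr : Module.End ℝ (SiteY i × ι → ℝ)) (B S A Sb : Module.End ℂ (SiteY i → 𝔸))
    (dB : ℕ) {κL κS κA θ κT r₀ rS rA rc rT δ₀ α β asep CS CA CT : ℝ}
    (hκL : 0 ≤ κL) (hκS : 0 ≤ κS) (hκA : 0 ≤ κA) (hθ : 0 ≤ θ) (hκT : 0 ≤ κT) (hCS : 0 ≤ CS) (hCA : 0 ≤ CA) (hCT : 0 ≤ CT)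
    (hαδ : 0 ≤ α * δ₀) (hε0 : 0 ≤ (α + β) * δ₀) (hasep : 0 ≤ asep) (hρ : 0 ≤ r₀ - 4 * ((α + β) * δ₀) - asep)
    (hrS : r₀ - (α + β) * δ₀ ≤ rS) (hrA : r₀ - 2 * ((α + β) * δ₀) ≤ rA) (hrc : r₀ - 3 * ((α + β) * δ₀) - asep ≤ rc)
    (hrT : r₀ - 4 * ((α + β) * δ₀) - asep ≤ rT)
    (hSTS : ScaleTransfer (geo9K i) δ₀ α CS (fun a => ((geo9K i).len a ^ 4)⁻¹)) (hSTA : ScaleTransfer (geo9K i) δ₀ α CA (fun a => (geo9K i).len a ^ 2))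
    (hSTT : ScaleTransfer (geo9K i) δ₀ α CT (fun a => ((geo9K i).len a)⁻¹)) (h261 : Ineq261 dB (toB6 (geo9K i) Rr' Hp) δ₀ β)
    (hL : HasMajorant (g := toB6 (geo9K i) Rr' Hp) (fun p : SiteY i × ι => ιB (blkOf i.D.toDomains p.1))
      (Dl * mulOp (fun p : SiteY i × ι => bumpY i (ctrR i c) (3 * (SC i c : ℝ)) p.1) * conj b (B.restrictScalars ℝ))
      (fun a a' : (geo9K i).Site => (if a ∈ S_L then (1 : ℝ) else 0) * (κL * (geo9K i).len a * Real.exp (-(r₀ * (geo9K i).dist a a')))))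
    (hS : HasMajorant (g := toB6 (geo9K i) Rr' Hp) (fun p : SiteY i × ι => ιB (blkOf i.D.toDomains p.1)) (conj b (S.restrictScalars ℝ))
      (fun a a' => κS * ((geo9K i).len a ^ 4)⁻¹ * Real.exp (-(rS * (geo9K i).dist a a'))))
    (hA : HasMajorant (g := toB6 (geo9K i) Rr' Hp) (fun p : SiteY i × ι => ιB (blkOf i.D.toDomains p.1)) (conj b (A.restrictScalars ℝ))
      (fun a a' => κA * (geo9K i).len a ^ 2 * Real.exp (-(rA * (geo9K i).dist a a'))))
    (hRc : HasMajorant (g := toB6 (geo9K i) Rr' Hp) (fun p : SiteY i × ι => ιB (blkOf i.D.toDomains p.1))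
      (conj b (((cutMulY (𝔸 := 𝔸) (chiY i c) * deltaPrimeACubeY i c (parSymY i) V' - deltaPrimeACubeY i c (parSymY i) V' * cutMulY (𝔸 := 𝔸) (chiY i c)) *
        GpCubeY i c (parSymY i) V').restrictScalars ℝ))
      (fun a a' => θ * Real.exp (-(rc * (geo9K i).dist a a'))))
    (hTail1 : HasMajorant (g := toB6 (geo9K i) Rr' Hp) (fun p : SiteY i × ι => ιB (blkOf i.D.toDomains p.1))
      (conj b (B.restrictScalars ℝ) * (conj b (Sb.restrictScalars ℝ) * mulOp (fun p : SiteY i × ι => if NearC i c (3 * SC i c) p.1.1 then (1 : ℝ) else 0) *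
        (conj b (B.restrictScalars ℝ) * mulOp (fun p : SiteY i × ι => bumpY i (ctrR i c) (3 * (SC i c : ℝ)) p.1) * Dr)))
      (fun a a' => κT * ((geo9K i).len a)⁻¹ * Real.exp (-(rT * (geo9K i).dist a a')))) :
    HasMajorant (g := toB6 (geo9K i) Rr' Hp) (fun p : SiteY i × ι => ιB (blkOf i.D.toDomains p.1))
      (Dl * conj b ((cutMulY (𝔸 := 𝔸) (bumpY i (ctrR i c) (3 * (SC i c : ℝ))) * B *
          (cutMulY (𝔸 := 𝔸) (fun z : SiteY i => if NearC i c (3 * SC i c) z.1 then (1 : ℝ) else 0) * S * A *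
            ((cutMulY (𝔸 := 𝔸) (chiY i c) * deltaPrimeACubeY i c (parSymY i) V' - deltaPrimeACubeY i c (parSymY i) V' * cutMulY (𝔸 := 𝔸) (chiY i c)) *
              GpCubeY i c (parSymY i) V') * B * Sb *
            cutMulY (𝔸 := 𝔸) (fun z : SiteY i => if NearC i c (3 * SC i c) z.1 then (1 : ℝ) else 0)) * B *
          cutMulY (𝔸 := 𝔸) (bumpY i (ctrR i c) (3 * (SC i c : ℝ)))).restrictScalars ℝ) * Dr)
      (fun a a' : (geo9K i).Site => (if a ∈ S_L then (1 : ℝ) else 0) *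
        ((κL * κS * κA * θ * κT * (CS * CA * CT) * B6.c1 dB δ₀ β ^ 4 * Real.exp (-(asep * (3 / 8 * (i.Mh : ℝ) - 2)))) *
          ((geo9K i).len a * ((geo9K i).len a ^ 4)⁻¹ * (geo9K i).len a ^ 2 * ((geo9K i).len a)⁻¹) *
            Real.exp (-((r₀ - 4 * ((α + β) * δ₀) - asep) * (geo9K i).dist a a')))) := by
  obtain ⟨htri, -, hdnn⟩ := geo9K_axioms i Rr' Hp
  set χl : SiteY i → ℝ := bumpY i (ctrR i c) (3 * (SC i c : ℝ)) with hχl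
  set ind : SiteY i → ℝ := fun z => if NearC i c (3 * SC i c) z.1 then (1 : ℝ) else 0 with hind
  set Rχ : Module.End ℂ (SiteY i → 𝔸) :=
    (cutMulY (𝔸 := 𝔸) (chiY i c) * deltaPrimeACubeY i c (parSymY i) V' - deltaPrimeACubeY i c (parSymY i) V' * cutMulY (𝔸 := 𝔸) (chiY i c)) *
      GpCubeY i c (parSymY i) V' with hRχ
  have e1 : ((cutMulY (𝔸 := 𝔸) χl * B * (cutMulY (𝔸 := 𝔸) ind * S * A * Rχ * B * Sb * cutMulY (𝔸 := 𝔸) ind) * B * cutMulY (𝔸 := 𝔸) χl).restrictScalars ℝ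
        : Module.End ℝ (SiteY i → 𝔸)) =
      (cutMulY (𝔸 := 𝔸) χl).restrictScalars ℝ * B.restrictScalars ℝ *
        ((cutMulY (𝔸 := 𝔸) ind).restrictScalars ℝ * S.restrictScalars ℝ * A.restrictScalars ℝ * Rχ.restrictScalars ℝ * B.restrictScalars ℝ *
          Sb.restrictScalars ℝ * (cutMulY (𝔸 := 𝔸) ind).restrictScalars ℝ) * B.restrictScalars ℝ * (cutMulY (𝔸 := 𝔸) χl).restrictScalars ℝ :=
    LinearMap.ext fun _ => rfl
  rw [e1]
  simp only [B9Eq352DivFormLetters.conj_mul, conj_cutMulY]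
  rw [show Dl * (mulOp (fun p : SiteY i × ι => χl p.1) * conj b (B.restrictScalars ℝ) *
        (mulOp (fun p : SiteY i × ι => ind p.1) * conj b (S.restrictScalars ℝ) * conj b (A.restrictScalars ℝ) * conj b (Rχ.restrictScalars ℝ) *
          conj b (B.restrictScalars ℝ) * conj b (Sb.restrictScalars ℝ) * mulOp (fun p : SiteY i × ι => ind p.1)) *
        conj b (B.restrictScalars ℝ) * mulOp (fun p : SiteY i × ι => χl p.1)) * Dr =
      (Dl * mulOp (fun p : SiteY i × ι => χl p.1) * conj b (B.restrictScalars ℝ) * mulOp (fun p : SiteY i × ι => ind p.1)) *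
        conj b (S.restrictScalars ℝ) * conj b (A.restrictScalars ℝ) * conj b (Rχ.restrictScalars ℝ) *
        (conj b (B.restrictScalars ℝ) * (conj b (Sb.restrictScalars ℝ) * mulOp (fun p : SiteY i × ι => ind p.1) *
          (conj b (B.restrictScalars ℝ) * mulOp (fun p : SiteY i × ι => χl p.1) * Dr))) from by simp only [mul_assoc]]
  have hL' := hasMajorant_mul_mulOp_le i (Rr' := Rr') (Hp := Hp) _ hL (fun p : SiteY i × ι => ind p.1) fun p => by
    simp only [hind]; split_ifs <;> simp
  have hsep : ∀ a ∈ S_L,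
      ∀ y ∈ (Finset.univ.filter fun a : IBondY i => ∃ z : SiteY i, ιB (blkOf i.D.toDomains z) = a ∧ ¬ NearC i c (3 * SC i c - (bS i c : ℤ)) z.1),
        3 / 8 * (i.Mh : ℝ) - 2 ≤ (geo9K i).dist a y := fun a ha y hy => by
    obtain ⟨z, rfl, hz⟩ := hSL a ha
    obtain ⟨w, rfl, hw⟩ := (Finset.mem_filter.1 hy).2
    exact collar_le_dist_chiL_annulus i c ιB hι hz hw
  have hw1 : ∀ a : IBondY i, 0 ≤ (geo9K i).len a := fun a => (geo9K_len_pos i a).le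
  have h := word4_majorant_blk (Rg := Rr') (Hg := Hp) (fun p : SiteY i × ι => ιB (blkOf i.D.toDomains p.1)) dB S_L
    ((Finset.univ.filter fun a : IBondY i => ∃ z : SiteY i, ιB (blkOf i.D.toDomains z) = a ∧ ¬ NearC i c (3 * SC i c - (bS i c : ℤ)) z.1 :) :
      Finset (IBondY i))
    (fun p : SiteY i × ι => if NearC i c (3 * SC i c - (bS i c : ℤ)) p.1.1 then (0 : ℝ) else 1)
    (fun a => (geo9K i).len a) (fun a => ((geo9K i).len a ^ 4)⁻¹) (fun a => (geo9K i).len a ^ 2) (fun a => ((geo9K i).len a)⁻¹)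
    hκL hκS hκA hθ hκT hCS hCA hCT hw1 (fun a => by have := hw1 a; positivity) (fun a => by positivity) (fun a => by have := hw1 a; positivity)
    hαδ hε0 hasep hρ hrS hrA hrc hrT hdnn htri hSTS hSTA hSTT h261 (fun p => by split_ifs <;> simp)
    (fun p hp => by by_contra h; exact hp (transIndSite_mem i c ιB p h)) (mulOp_transInd_mul_conj_commStep i c b (parSymY i) V') hsep hL' hS hA hRc hTail1
  exact h

omit [CompleteSpace 𝔸] in
open Classical in
set_option maxHeartbeats 1600000 in
/-- ★★★ **WORD 2 AT THE SITE CARRIER** — `D_l·conj((M_lB·(M₂S(AA)(1 − M_{χ_□})PS_□M₂)·BM_l)^ℝ)·D_r`: the far factor `1 − χ_□` vanishes on `NearC 3S_j` (separation `3M_h∕8 − 1`,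
p38 `collar_le_dist_chiL_chiY`), the member projection `P` block-local (`≺ κ_P𝟙`), the tail `S_□M₂·BM_lD_r` (weight `ℓ⁻³`) displayed:
`≺ 𝟙[a ∈ S_L]·(κ_Lκ_Sκ_A²κ_Pκ_T·C_SC_A²C_T·c₁⁴·e^{−a_sep(3M_h∕8 − 1)})·(ℓℓ⁻⁴(ℓ²)²ℓ⁻³)(a)·e^{−(r₀ − 4ε − a_sep)d}`.
[cite: Balaban1985BackgroundPropagators, p.412 l.22–36, p.415 l.29–37, (3.19)–(3.21) pp.393–394, (3.48)–(3.49) pp.398–399; Balaban1984PropagatorsII, (2.83)–(2.85) pp.237–238, (2.52)–(2.55) p.232, (2.60)–(2.61) p.234] -/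
theorem hasMajorant_word2_at (ιB : BlkY i → IBondY i) (hι : ∀ s, β i.hN i.D i.hk (ιB s) = s)
    (S_L : Finset (geo9K i).Site) (hSL : ∀ a ∈ S_L, ∃ z : SiteY i, ιB (blkOf i.D.toDomains z) = a ∧ NearC i c (21 * SC i c / 8 + 1) z.1)
    (Dl Dr : Module.End ℝ (SiteY i × ι → ℝ)) (B S A P Sb : Module.End ℂ (SiteY i → 𝔸))
    (dB : ℕ) {κL κS κA κP κT r₀ rS rA rT δ₀ α β asep CS CA CT : ℝ}
    (hκL : 0 ≤ κL) (hκS : 0 ≤ κS) (hκA : 0 ≤ κA) (hκP : 0 ≤ κP) (hκT : 0 ≤ κT) (hCS : 0 ≤ CS) (hCA : 0 ≤ CA) (hCT : 0 ≤ CT)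
    (hε0 : 0 ≤ (α + β) * δ₀) (hasep : 0 ≤ asep) (hρ : 0 ≤ r₀ - 4 * ((α + β) * δ₀) - asep)
    (hrS : r₀ - (α + β) * δ₀ ≤ rS) (hrA : r₀ - 2 * ((α + β) * δ₀) ≤ rA) (hrT : r₀ - 4 * ((α + β) * δ₀) - asep ≤ rT)
    (hSTS : ScaleTransfer (geo9K i) δ₀ α CS (fun a => ((geo9K i).len a ^ 4)⁻¹)) (hSTA : ScaleTransfer (geo9K i) δ₀ α CA (fun a => (geo9K i).len a ^ 2))
    (hSTT : ScaleTransfer (geo9K i) δ₀ α CT (fun a => ((geo9K i).len a ^ 3)⁻¹)) (h261 : Ineq261 dB (toB6 (geo9K i) Rr' Hp) δ₀ β)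
    (hL : HasMajorant (g := toB6 (geo9K i) Rr' Hp) (fun p : SiteY i × ι => ιB (blkOf i.D.toDomains p.1))
      (Dl * mulOp (fun p : SiteY i × ι => bumpY i (ctrR i c) (3 * (SC i c : ℝ)) p.1) * conj b (B.restrictScalars ℝ))
      (fun a a' : (geo9K i).Site => (if a ∈ S_L then (1 : ℝ) else 0) * (κL * (geo9K i).len a * Real.exp (-(r₀ * (geo9K i).dist a a')))))
    (hS : HasMajorant (g := toB6 (geo9K i) Rr' Hp) (fun p : SiteY i × ι => ιB (blkOf i.D.toDomains p.1)) (conj b (S.restrictScalars ℝ))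
      (fun a a' => κS * ((geo9K i).len a ^ 4)⁻¹ * Real.exp (-(rS * (geo9K i).dist a a'))))
    (hA : HasMajorant (g := toB6 (geo9K i) Rr' Hp) (fun p : SiteY i × ι => ιB (blkOf i.D.toDomains p.1)) (conj b (A.restrictScalars ℝ))
      (fun a a' => κA * (geo9K i).len a ^ 2 * Real.exp (-(rA * (geo9K i).dist a a'))))
    (hP : HasMajorant (g := toB6 (geo9K i) Rr' Hp) (fun p : SiteY i × ι => ιB (blkOf i.D.toDomains p.1)) (conj b (P.restrictScalars ℝ))
      (fun a a' : (geo9K i).Site => if a = a' then κP else 0))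
    (hTail0 : HasMajorant (g := toB6 (geo9K i) Rr' Hp) (fun p : SiteY i × ι => ιB (blkOf i.D.toDomains p.1))
      (conj b (Sb.restrictScalars ℝ) * mulOp (fun p : SiteY i × ι => if NearC i c (3 * SC i c) p.1.1 then (1 : ℝ) else 0) *
        (conj b (B.restrictScalars ℝ) * mulOp (fun p : SiteY i × ι => bumpY i (ctrR i c) (3 * (SC i c : ℝ)) p.1) * Dr))
      (fun a a' => κT * ((geo9K i).len a ^ 3)⁻¹ * Real.exp (-(rT * (geo9K i).dist a a')))) :
    HasMajorant (g := toB6 (geo9K i) Rr' Hp) (fun p : SiteY i × ι => ιB (blkOf i.D.toDomains p.1))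
      (Dl * conj b ((cutMulY (𝔸 := 𝔸) (bumpY i (ctrR i c) (3 * (SC i c : ℝ))) * B *
          (cutMulY (𝔸 := 𝔸) (fun z : SiteY i => if NearC i c (3 * SC i c) z.1 then (1 : ℝ) else 0) * S * (A * A) *
            (1 - cutMulY (𝔸 := 𝔸) (chiY i c)) * P * Sb *
            cutMulY (𝔸 := 𝔸) (fun z : SiteY i => if NearC i c (3 * SC i c) z.1 then (1 : ℝ) else 0)) * B *
          cutMulY (𝔸 := 𝔸) (bumpY i (ctrR i c) (3 * (SC i c : ℝ)))).restrictScalars ℝ) * Dr)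
      (fun a a' : (geo9K i).Site => (if a ∈ S_L then (1 : ℝ) else 0) *
        ((κL * κS * κA ^ 2 * κP * κT * (CS * CA ^ 2 * CT) * B6.c1 dB δ₀ β ^ 4 * Real.exp (-(asep * (3 / 8 * (i.Mh : ℝ) - 1)))) *
          ((geo9K i).len a * ((geo9K i).len a ^ 4)⁻¹ * ((geo9K i).len a ^ 2) ^ 2 * ((geo9K i).len a ^ 3)⁻¹) *
            Real.exp (-((r₀ - 4 * ((α + β) * δ₀) - asep) * (geo9K i).dist a a')))) := by
  obtain ⟨htri, -, hdnn⟩ := geo9K_axioms i Rr' Hp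
  set χl : SiteY i → ℝ := bumpY i (ctrR i c) (3 * (SC i c : ℝ)) with hχl
  set ind : SiteY i → ℝ := fun z => if NearC i c (3 * SC i c) z.1 then (1 : ℝ) else 0 with hind
  rw [one_sub_cutMulY i (chiY i c)]
  have e1 : ((cutMulY (𝔸 := 𝔸) χl * B * (cutMulY (𝔸 := 𝔸) ind * S * (A * A) * cutMulY (𝔸 := 𝔸) (fun z => 1 - chiY i c z) * P * Sb *
        cutMulY (𝔸 := 𝔸) ind) * B * cutMulY (𝔸 := 𝔸) χl).restrictScalars ℝ : Module.End ℝ (SiteY i → 𝔸)) =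
      (cutMulY (𝔸 := 𝔸) χl).restrictScalars ℝ * B.restrictScalars ℝ *
        ((cutMulY (𝔸 := 𝔸) ind).restrictScalars ℝ * S.restrictScalars ℝ * (A.restrictScalars ℝ * A.restrictScalars ℝ) *
          (cutMulY (𝔸 := 𝔸) (fun z => 1 - chiY i c z)).restrictScalars ℝ * P.restrictScalars ℝ * Sb.restrictScalars ℝ * (cutMulY (𝔸 := 𝔸) ind).restrictScalars ℝ) *
        B.restrictScalars ℝ * (cutMulY (𝔸 := 𝔸) χl).restrictScalars ℝ :=
    LinearMap.ext fun _ => rfl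
  rw [e1]
  simp only [B9Eq352DivFormLetters.conj_mul, conj_cutMulY]
  rw [show Dl * (mulOp (fun p : SiteY i × ι => χl p.1) * conj b (B.restrictScalars ℝ) *
        (mulOp (fun p : SiteY i × ι => ind p.1) * conj b (S.restrictScalars ℝ) * (conj b (A.restrictScalars ℝ) * conj b (A.restrictScalars ℝ)) *
          mulOp (fun p : SiteY i × ι => 1 - chiY i c p.1) * conj b (P.restrictScalars ℝ) * conj b (Sb.restrictScalars ℝ) * mulOp (fun p : SiteY i × ι => ind p.1)) *
        conj b (B.restrictScalars ℝ) * mulOp (fun p : SiteY i × ι => χl p.1)) * Dr =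
      (Dl * mulOp (fun p : SiteY i × ι => χl p.1) * conj b (B.restrictScalars ℝ) * mulOp (fun p : SiteY i × ι => ind p.1)) *
        conj b (S.restrictScalars ℝ) * conj b (A.restrictScalars ℝ) * conj b (A.restrictScalars ℝ) * mulOp (fun p : SiteY i × ι => 1 - chiY i c p.1) *
        conj b (P.restrictScalars ℝ) *
        (conj b (Sb.restrictScalars ℝ) * mulOp (fun p : SiteY i × ι => ind p.1) *
          (conj b (B.restrictScalars ℝ) * mulOp (fun p : SiteY i × ι => χl p.1) * Dr)) from by simp only [mul_assoc]]
  have hL' := hasMajorant_mul_mulOp_le i (Rr' := Rr') (Hp := Hp) _ hL (fun p : SiteY i × ι => ind p.1) fun p => by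
    simp only [hind]; split_ifs <;> simp
  have hsep : ∀ a ∈ S_L,
      ∀ y ∈ (Finset.univ.filter fun a : IBondY i => ∃ z : SiteY i, ιB (blkOf i.D.toDomains z) = a ∧ chiY i c z ≠ 1),
        3 / 8 * (i.Mh : ℝ) - 1 ≤ (geo9K i).dist a y := fun a ha y hy => by
    obtain ⟨z, rfl, hz⟩ := hSL a ha
    obtain ⟨w, rfl, hw⟩ := (Finset.mem_filter.1 hy).2
    exact collar_le_dist_chiL_chiY i c ιB hι hz hw
  have hw1 : ∀ a : IBondY i, 0 ≤ (geo9K i).len a := fun a => (geo9K_len_pos i a).le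
  have h := word2_majorant_blk (Rg := Rr') (Hg := Hp) (fun p : SiteY i × ι => ιB (blkOf i.D.toDomains p.1)) dB S_L
    ((Finset.univ.filter fun a : IBondY i => ∃ z : SiteY i, ιB (blkOf i.D.toDomains z) = a ∧ chiY i c z ≠ 1 :) : Finset (IBondY i))
    (fun p : SiteY i × ι => 1 - chiY i c p.1)
    (fun a => (geo9K i).len a) (fun a => ((geo9K i).len a ^ 4)⁻¹) (fun a => (geo9K i).len a ^ 2) (fun a => ((geo9K i).len a ^ 3)⁻¹)
    hκL hκS hκA hκP hκT hCS hCA hCT hw1 (fun a => by have := hw1 a; positivity) (fun a => by positivity) (fun a => by have := hw1 a; positivity)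
    hε0 hasep hρ hrS hrA hrT hdnn htri hSTS hSTA hSTT h261 (fun p => abs_one_sub_chiY_le_one i c p.1)
    (fun p hp => Finset.mem_filter.2 ⟨@Finset.mem_univ _ (_) _, p.1, rfl, fun h1 => hp (by rw [h1, sub_self])⟩) hsep hL' hS hA hP hTail0
  exact h

omit [CompleteSpace 𝔸] in
open Classical in
set_option maxHeartbeats 1600000 in
/-- ★★★ **WORD 1 AT THE SITE CARRIER** — `D_l·conj((M_lB·(M₂SP_□(1 − M_{χ_□})(BB)S_□M₂)·BM_l)^ℝ)·D_r`: the cube projection `P_□` block-local on the member's carrier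
(`≺ κ_P𝟙`), the far factor `1 − χ_□` (separation `3M_h∕8 − 1`), the tail `BB·S_□M₂·BM_lD_r` (weight `ℓ`) displayed:
`≺ 𝟙[a ∈ S_L]·(κ_Lκ_Sκ_Pκ_T·C_SC_T·c₁²·e^{−a_sep(3M_h∕8 − 1)})·(ℓℓ⁻⁴ℓ)(a)·e^{−(r₀ − 2ε − a_sep)d}`.
[cite: Balaban1985BackgroundPropagators, p.412 l.22–36, p.415 l.29–37, (3.19)–(3.21) pp.393–394, (3.48)–(3.49) pp.398–399; Balaban1984PropagatorsII, (2.83)–(2.85) pp.237–238, (2.52)–(2.55) p.232, (2.60)–(2.61) p.234] -/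
theorem hasMajorant_word1_at (ιB : BlkY i → IBondY i) (hι : ∀ s, β i.hN i.D i.hk (ιB s) = s)
    (S_L : Finset (geo9K i).Site) (hSL : ∀ a ∈ S_L, ∃ z : SiteY i, ιB (blkOf i.D.toDomains z) = a ∧ NearC i c (21 * SC i c / 8 + 1) z.1)
    (Dl Dr : Module.End ℝ (SiteY i × ι → ℝ)) (B S Pb Sb : Module.End ℂ (SiteY i → 𝔸))
    (dB : ℕ) {κL κS κP κT r₀ rS rT δ₀ α β asep CS CT : ℝ}
    (hκL : 0 ≤ κL) (hκS : 0 ≤ κS) (hκP : 0 ≤ κP) (hκT : 0 ≤ κT) (hCS : 0 ≤ CS) (hCT : 0 ≤ CT)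
    (hε0 : 0 ≤ (α + β) * δ₀) (hasep : 0 ≤ asep) (hρ : 0 ≤ r₀ - 2 * ((α + β) * δ₀) - asep)
    (hrS : r₀ - (α + β) * δ₀ ≤ rS) (hrT : r₀ - 2 * ((α + β) * δ₀) - asep ≤ rT)
    (hSTS : ScaleTransfer (geo9K i) δ₀ α CS (fun a => ((geo9K i).len a ^ 4)⁻¹)) (hSTT : ScaleTransfer (geo9K i) δ₀ α CT (fun a => (geo9K i).len a))
    (h261 : Ineq261 dB (toB6 (geo9K i) Rr' Hp) δ₀ β)
    (hL : HasMajorant (g := toB6 (geo9K i) Rr' Hp) (fun p : SiteY i × ι => ιB (blkOf i.D.toDomains p.1))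
      (Dl * mulOp (fun p : SiteY i × ι => bumpY i (ctrR i c) (3 * (SC i c : ℝ)) p.1) * conj b (B.restrictScalars ℝ))
      (fun a a' : (geo9K i).Site => (if a ∈ S_L then (1 : ℝ) else 0) * (κL * (geo9K i).len a * Real.exp (-(r₀ * (geo9K i).dist a a')))))
    (hS : HasMajorant (g := toB6 (geo9K i) Rr' Hp) (fun p : SiteY i × ι => ιB (blkOf i.D.toDomains p.1)) (conj b (S.restrictScalars ℝ))
      (fun a a' => κS * ((geo9K i).len a ^ 4)⁻¹ * Real.exp (-(rS * (geo9K i).dist a a'))))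
    (hPb : HasMajorant (g := toB6 (geo9K i) Rr' Hp) (fun p : SiteY i × ι => ιB (blkOf i.D.toDomains p.1)) (conj b (Pb.restrictScalars ℝ))
      (fun a a' : (geo9K i).Site => if a = a' then κP else 0))
    (hTail2 : HasMajorant (g := toB6 (geo9K i) Rr' Hp) (fun p : SiteY i × ι => ιB (blkOf i.D.toDomains p.1))
      (conj b (B.restrictScalars ℝ) * conj b (B.restrictScalars ℝ) *
        (conj b (Sb.restrictScalars ℝ) * mulOp (fun p : SiteY i × ι => if NearC i c (3 * SC i c) p.1.1 then (1 : ℝ) else 0) *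
          (conj b (B.restrictScalars ℝ) * mulOp (fun p : SiteY i × ι => bumpY i (ctrR i c) (3 * (SC i c : ℝ)) p.1) * Dr)))
      (fun a a' => κT * (geo9K i).len a * Real.exp (-(rT * (geo9K i).dist a a')))) :
    HasMajorant (g := toB6 (geo9K i) Rr' Hp) (fun p : SiteY i × ι => ιB (blkOf i.D.toDomains p.1))
      (Dl * conj b ((cutMulY (𝔸 := 𝔸) (bumpY i (ctrR i c) (3 * (SC i c : ℝ))) * B *
          (cutMulY (𝔸 := 𝔸) (fun z : SiteY i => if NearC i c (3 * SC i c) z.1 then (1 : ℝ) else 0) * S * Pb *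
            (1 - cutMulY (𝔸 := 𝔸) (chiY i c)) * (B * B) * Sb *
            cutMulY (𝔸 := 𝔸) (fun z : SiteY i => if NearC i c (3 * SC i c) z.1 then (1 : ℝ) else 0)) * B *
          cutMulY (𝔸 := 𝔸) (bumpY i (ctrR i c) (3 * (SC i c : ℝ)))).restrictScalars ℝ) * Dr)
      (fun a a' : (geo9K i).Site => (if a ∈ S_L then (1 : ℝ) else 0) *
        ((κL * κS * κP * κT * (CS * CT) * B6.c1 dB δ₀ β ^ 2 * Real.exp (-(asep * (3 / 8 * (i.Mh : ℝ) - 1)))) *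
          ((geo9K i).len a * ((geo9K i).len a ^ 4)⁻¹ * (geo9K i).len a) *
            Real.exp (-((r₀ - 2 * ((α + β) * δ₀) - asep) * (geo9K i).dist a a')))) := by
  obtain ⟨htri, -, hdnn⟩ := geo9K_axioms i Rr' Hp
  set χl : SiteY i → ℝ := bumpY i (ctrR i c) (3 * (SC i c : ℝ)) with hχl
  set ind : SiteY i → ℝ := fun z => if NearC i c (3 * SC i c) z.1 then (1 : ℝ) else 0 with hind
  rw [one_sub_cutMulY i (chiY i c)]
  have e1 : ((cutMulY (𝔸 := 𝔸) χl * B * (cutMulY (𝔸 := 𝔸) ind * S * Pb * cutMulY (𝔸 := 𝔸) (fun z => 1 - chiY i c z) * (B * B) * Sb *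
        cutMulY (𝔸 := 𝔸) ind) * B * cutMulY (𝔸 := 𝔸) χl).restrictScalars ℝ : Module.End ℝ (SiteY i → 𝔸)) =
      (cutMulY (𝔸 := 𝔸) χl).restrictScalars ℝ * B.restrictScalars ℝ *
        ((cutMulY (𝔸 := 𝔸) ind).restrictScalars ℝ * S.restrictScalars ℝ * Pb.restrictScalars ℝ *
          (cutMulY (𝔸 := 𝔸) (fun z => 1 - chiY i c z)).restrictScalars ℝ * (B.restrictScalars ℝ * B.restrictScalars ℝ) * Sb.restrictScalars ℝ *
          (cutMulY (𝔸 := 𝔸) ind).restrictScalars ℝ) *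
        B.restrictScalars ℝ * (cutMulY (𝔸 := 𝔸) χl).restrictScalars ℝ :=
    LinearMap.ext fun _ => rfl
  rw [e1]
  simp only [B9Eq352DivFormLetters.conj_mul, conj_cutMulY]
  rw [show Dl * (mulOp (fun p : SiteY i × ι => χl p.1) * conj b (B.restrictScalars ℝ) *
        (mulOp (fun p : SiteY i × ι => ind p.1) * conj b (S.restrictScalars ℝ) * conj b (Pb.restrictScalars ℝ) *
          mulOp (fun p : SiteY i × ι => 1 - chiY i c p.1) * (conj b (B.restrictScalars ℝ) * conj b (B.restrictScalars ℝ)) * conj b (Sb.restrictScalars ℝ) *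
          mulOp (fun p : SiteY i × ι => ind p.1)) *
        conj b (B.restrictScalars ℝ) * mulOp (fun p : SiteY i × ι => χl p.1)) * Dr =
      (Dl * mulOp (fun p : SiteY i × ι => χl p.1) * conj b (B.restrictScalars ℝ) * mulOp (fun p : SiteY i × ι => ind p.1)) *
        conj b (S.restrictScalars ℝ) * conj b (Pb.restrictScalars ℝ) * mulOp (fun p : SiteY i × ι => 1 - chiY i c p.1) *
        (conj b (B.restrictScalars ℝ) * conj b (B.restrictScalars ℝ) *
          (conj b (Sb.restrictScalars ℝ) * mulOp (fun p : SiteY i × ι => ind p.1) *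
            (conj b (B.restrictScalars ℝ) * mulOp (fun p : SiteY i × ι => χl p.1) * Dr))) from by simp only [mul_assoc]]
  have hL' := hasMajorant_mul_mulOp_le i (Rr' := Rr') (Hp := Hp) _ hL (fun p : SiteY i × ι => ind p.1) fun p => by
    simp only [hind]; split_ifs <;> simp
  have hsep : ∀ a ∈ S_L,
      ∀ y ∈ (Finset.univ.filter fun a : IBondY i => ∃ z : SiteY i, ιB (blkOf i.D.toDomains z) = a ∧ chiY i c z ≠ 1),
        3 / 8 * (i.Mh : ℝ) - 1 ≤ (geo9K i).dist a y := fun a ha y hy => by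
    obtain ⟨z, rfl, hz⟩ := hSL a ha
    obtain ⟨w, rfl, hw⟩ := (Finset.mem_filter.1 hy).2
    exact collar_le_dist_chiL_chiY i c ιB hι hz hw
  have hw1 : ∀ a : IBondY i, 0 ≤ (geo9K i).len a := fun a => (geo9K_len_pos i a).le
  have h := word1_majorant_blk (Rg := Rr') (Hg := Hp) (fun p : SiteY i × ι => ιB (blkOf i.D.toDomains p.1)) dB S_L
    ((Finset.univ.filter fun a : IBondY i => ∃ z : SiteY i, ιB (blkOf i.D.toDomains z) = a ∧ chiY i c z ≠ 1 :) : Finset (IBondY i))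
    (fun p : SiteY i × ι => 1 - chiY i c p.1)
    (fun a => (geo9K i).len a) (fun a => ((geo9K i).len a ^ 4)⁻¹) (fun a => (geo9K i).len a)
    hκL hκS hκP hκT hCS hCT hw1 (fun a => by have := hw1 a; positivity) hw1
    hε0 hasep hρ hrS hrT hdnn htri hSTS hSTT h261 (fun p => abs_one_sub_chiY_le_one i c p.1)
    (fun p hp => Finset.mem_filter.2 ⟨@Finset.mem_univ _ (_) _, p.1, rfl, fun h1 => hp (by rw [h1, sub_self])⟩) hsep hL' hS hPb hTail2
  exact h


omit [CompleteSpace 𝔸] in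
open Classical in
set_option maxHeartbeats 1600000 in
/-- ★★ **LEAK A AT THE SITE CARRIER** — `D_l·conj((M_lB·(M₂X(1 − M₂))·BM_l)^ℝ)·D_r` (`X = S` or `S_□`; p38's `sandwich_split` middle leak): the far factor `1 − M₂`
(`M₂ = 𝟙[NearC 3S_j]`, separation `3M_h∕8 − 1` from the located rows, `collar_le_dist_chiL_notNear`) between the near-row letter `M₂X` (weight `ℓ⁻⁴`, displayed) and the
right entry `BM_lD_r` (weight `ℓ`, displayed): `≺ 𝟙[a ∈ S_L]·(κ_Lκ_Xκ_R·C_SC_R·c₁²·e^{−a_sep(3M_h∕8 − 1)})·(ℓℓ⁻⁴ℓ)(a)·e^{−(r₀ − 2ε − a_sep)d}`.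
[cite: Balaban1985BackgroundPropagators, p.415 l.26–37, p.412 l.22–36; Balaban1984PropagatorsII, (2.83)–(2.85) pp.237–238, (2.52)–(2.55) p.232, (2.60)–(2.61) p.234] -/
theorem hasMajorant_leakA_at (ιB : BlkY i → IBondY i) (hι : ∀ s, β i.hN i.D i.hk (ιB s) = s)
    (S_L : Finset (geo9K i).Site) (hSL : ∀ a ∈ S_L, ∃ z : SiteY i, ιB (blkOf i.D.toDomains z) = a ∧ NearC i c (21 * SC i c / 8 + 1) z.1)
    (Dl Dr : Module.End ℝ (SiteY i × ι → ℝ)) (B X : Module.End ℂ (SiteY i → 𝔸))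
    (dB : ℕ) {κL κX κR r₀ rX rR δ₀ α β asep CS CR : ℝ}
    (hκL : 0 ≤ κL) (hκX : 0 ≤ κX) (hκR : 0 ≤ κR) (hCS : 0 ≤ CS) (hCR : 0 ≤ CR)
    (hε0 : 0 ≤ (α + β) * δ₀) (hasep : 0 ≤ asep) (hρ : 0 ≤ r₀ - 2 * ((α + β) * δ₀) - asep)
    (hrX : r₀ - (α + β) * δ₀ ≤ rX) (hrR : r₀ - 2 * ((α + β) * δ₀) - asep ≤ rR)
    (hSTS : ScaleTransfer (geo9K i) δ₀ α CS (fun a => ((geo9K i).len a ^ 4)⁻¹)) (hST1 : ScaleTransfer (geo9K i) δ₀ α CR (fun a => (geo9K i).len a))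
    (h261 : Ineq261 dB (toB6 (geo9K i) Rr' Hp) δ₀ β)
    (hL : HasMajorant (g := toB6 (geo9K i) Rr' Hp) (fun p : SiteY i × ι => ιB (blkOf i.D.toDomains p.1))
      (Dl * mulOp (fun p : SiteY i × ι => bumpY i (ctrR i c) (3 * (SC i c : ℝ)) p.1) * conj b (B.restrictScalars ℝ))
      (fun a a' : (geo9K i).Site => (if a ∈ S_L then (1 : ℝ) else 0) * (κL * (geo9K i).len a * Real.exp (-(r₀ * (geo9K i).dist a a')))))
    (hX : HasMajorant (g := toB6 (geo9K i) Rr' Hp) (fun p : SiteY i × ι => ιB (blkOf i.D.toDomains p.1))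
      (mulOp (fun p : SiteY i × ι => if NearC i c (3 * SC i c) p.1.1 then (1 : ℝ) else 0) * conj b (X.restrictScalars ℝ))
      (fun a a' => κX * ((geo9K i).len a ^ 4)⁻¹ * Real.exp (-(rX * (geo9K i).dist a a'))))
    (hRop : HasMajorant (g := toB6 (geo9K i) Rr' Hp) (fun p : SiteY i × ι => ιB (blkOf i.D.toDomains p.1))
      (conj b (B.restrictScalars ℝ) * mulOp (fun p : SiteY i × ι => bumpY i (ctrR i c) (3 * (SC i c : ℝ)) p.1) * Dr)
      (fun a a' => κR * (geo9K i).len a * Real.exp (-(rR * (geo9K i).dist a a')))) :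
    HasMajorant (g := toB6 (geo9K i) Rr' Hp) (fun p : SiteY i × ι => ιB (blkOf i.D.toDomains p.1))
      (Dl * conj b ((cutMulY (𝔸 := 𝔸) (bumpY i (ctrR i c) (3 * (SC i c : ℝ))) * B *
          (cutMulY (𝔸 := 𝔸) (fun z : SiteY i => if NearC i c (3 * SC i c) z.1 then (1 : ℝ) else 0) * X *
            (1 - cutMulY (𝔸 := 𝔸) (fun z : SiteY i => if NearC i c (3 * SC i c) z.1 then (1 : ℝ) else 0))) * B *
          cutMulY (𝔸 := 𝔸) (bumpY i (ctrR i c) (3 * (SC i c : ℝ)))).restrictScalars ℝ) * Dr)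
      (fun a a' : (geo9K i).Site => (if a ∈ S_L then (1 : ℝ) else 0) *
        ((κL * κX * κR * (CS * CR) * B6.c1 dB δ₀ β ^ 2 * Real.exp (-(asep * (3 / 8 * (i.Mh : ℝ) - 1)))) *
          ((geo9K i).len a * ((geo9K i).len a ^ 4)⁻¹ * (geo9K i).len a) *
            Real.exp (-((r₀ - 2 * ((α + β) * δ₀) - asep) * (geo9K i).dist a a')))) := by
  obtain ⟨htri, -, hdnn⟩ := geo9K_axioms i Rr' Hp
  set χl : SiteY i → ℝ := bumpY i (ctrR i c) (3 * (SC i c : ℝ)) with hχl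
  set ind : SiteY i → ℝ := fun z => if NearC i c (3 * SC i c) z.1 then (1 : ℝ) else 0 with hind
  rw [one_sub_cutMulY i ind]
  have e1 : ((cutMulY (𝔸 := 𝔸) χl * B * (cutMulY (𝔸 := 𝔸) ind * X * cutMulY (𝔸 := 𝔸) (fun z => 1 - ind z)) * B * cutMulY (𝔸 := 𝔸) χl).restrictScalars ℝ
        : Module.End ℝ (SiteY i → 𝔸)) =
      (cutMulY (𝔸 := 𝔸) χl).restrictScalars ℝ * B.restrictScalars ℝ *
        ((cutMulY (𝔸 := 𝔸) ind).restrictScalars ℝ * X.restrictScalars ℝ * (cutMulY (𝔸 := 𝔸) (fun z => 1 - ind z)).restrictScalars ℝ) *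
        B.restrictScalars ℝ * (cutMulY (𝔸 := 𝔸) χl).restrictScalars ℝ := LinearMap.ext fun _ => rfl
  rw [e1]
  simp only [B9Eq352DivFormLetters.conj_mul, conj_cutMulY]
  rw [show Dl * (mulOp (fun p : SiteY i × ι => χl p.1) * conj b (B.restrictScalars ℝ) *
        (mulOp (fun p : SiteY i × ι => ind p.1) * conj b (X.restrictScalars ℝ) * mulOp (fun p : SiteY i × ι => 1 - ind p.1)) *
        conj b (B.restrictScalars ℝ) * mulOp (fun p : SiteY i × ι => χl p.1)) * Dr =
      (Dl * mulOp (fun p : SiteY i × ι => χl p.1) * conj b (B.restrictScalars ℝ)) * (mulOp (fun p : SiteY i × ι => ind p.1) * conj b (X.restrictScalars ℝ)) *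
        mulOp (fun p : SiteY i × ι => 1 - ind p.1) * (conj b (B.restrictScalars ℝ) * mulOp (fun p : SiteY i × ι => χl p.1) * Dr) from by
    simp only [mul_assoc]]
  have hsep : ∀ a ∈ S_L,
      ∀ y ∈ (Finset.univ.filter fun a : IBondY i => ∃ z : SiteY i, ιB (blkOf i.D.toDomains z) = a ∧ ¬ NearC i c (3 * SC i c) z.1),
        3 / 8 * (i.Mh : ℝ) - 1 ≤ (geo9K i).dist a y := fun a ha y hy => by
    obtain ⟨z, rfl, hz⟩ := hSL a ha
    obtain ⟨w, rfl, hw⟩ := (Finset.mem_filter.1 hy).2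
    exact collar_le_dist_chiL_notNear i c ιB hι hz hw
  have hw1 : ∀ a : IBondY i, 0 ≤ (geo9K i).len a := fun a => (geo9K_len_pos i a).le
  have h := leak_majorant_blk (Rg := Rr') (Hg := Hp) (fun p : SiteY i × ι => ιB (blkOf i.D.toDomains p.1)) dB S_L
    ((Finset.univ.filter fun a : IBondY i => ∃ z : SiteY i, ιB (blkOf i.D.toDomains z) = a ∧ ¬ NearC i c (3 * SC i c) z.1 :) : Finset (IBondY i))
    (fun p : SiteY i × ι => 1 - ind p.1)
    (fun a => (geo9K i).len a) (fun a => ((geo9K i).len a ^ 4)⁻¹) (fun a => (geo9K i).len a)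
    hκL hκX hκR hCS hCR hw1 (fun a => by have := hw1 a; positivity) hw1
    hε0 hasep hρ hrX hrR hdnn htri hSTS hST1 h261 (fun p => by simp only [hind]; split_ifs <;> simp)
    (fun p hp => Finset.mem_filter.2 ⟨@Finset.mem_univ _ (_) _, p.1, rfl, fun h1 => hp (by simp only [hind]; rw [if_pos h1, sub_self])⟩)
    hsep hL hX hRop
  exact h

omit [CompleteSpace 𝔸] in
open Classical in
set_option maxHeartbeats 1600000 in
/-- ★★ **LEAK B AT THE SITE CARRIER** — `D_l·conj((M_lB·((1 − M₂)X)·BM_l)^ℝ)·D_r`: the far factor `1 − M₂` right after the located left entry, then the tail `X·BM_lD_r`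
(weight `ℓ⁻³`, displayed): `≺ 𝟙[a ∈ S_L]·((κ_Le^{−a_sep(3M_h∕8 − 1)})κ_G·C_T·c₁)·(ℓℓ⁻³)(a)·e^{−ρd}`, `ρ + ε ≤ r₀ − a_sep`.
[cite: Balaban1985BackgroundPropagators, p.415 l.26–37, p.412 l.22–36; Balaban1984PropagatorsII, (2.83)–(2.85) pp.237–238, (2.52)–(2.55) p.232, (2.60)–(2.61) p.234] -/
theorem hasMajorant_leakB_at (ιB : BlkY i → IBondY i) (hι : ∀ s, β i.hN i.D i.hk (ιB s) = s)
    (S_L : Finset (geo9K i).Site) (hSL : ∀ a ∈ S_L, ∃ z : SiteY i, ιB (blkOf i.D.toDomains z) = a ∧ NearC i c (21 * SC i c / 8 + 1) z.1)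
    (Dl Dr : Module.End ℝ (SiteY i × ι → ℝ)) (B X : Module.End ℂ (SiteY i → 𝔸))
    (dB : ℕ) {κL κG r₀ rG ρ δ₀ α β asep CT : ℝ}
    (hκL : 0 ≤ κL) (hκG : 0 ≤ κG) (hCT : 0 ≤ CT) (hρ : 0 ≤ ρ) (hasep : 0 ≤ asep)
    (hr : ρ + (α + β) * δ₀ ≤ r₀ - asep) (hrG : ρ ≤ rG)
    (hSTT : ScaleTransfer (geo9K i) δ₀ α CT (fun a => ((geo9K i).len a ^ 3)⁻¹)) (h261 : Ineq261 dB (toB6 (geo9K i) Rr' Hp) δ₀ β)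
    (hL : HasMajorant (g := toB6 (geo9K i) Rr' Hp) (fun p : SiteY i × ι => ιB (blkOf i.D.toDomains p.1))
      (Dl * mulOp (fun p : SiteY i × ι => bumpY i (ctrR i c) (3 * (SC i c : ℝ)) p.1) * conj b (B.restrictScalars ℝ))
      (fun a a' : (geo9K i).Site => (if a ∈ S_L then (1 : ℝ) else 0) * (κL * (geo9K i).len a * Real.exp (-(r₀ * (geo9K i).dist a a')))))
    (hG : HasMajorant (g := toB6 (geo9K i) Rr' Hp) (fun p : SiteY i × ι => ιB (blkOf i.D.toDomains p.1))
      (conj b (X.restrictScalars ℝ) * (conj b (B.restrictScalars ℝ) * mulOp (fun p : SiteY i × ι => bumpY i (ctrR i c) (3 * (SC i c : ℝ)) p.1) * Dr))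
      (fun a a' => κG * ((geo9K i).len a ^ 3)⁻¹ * Real.exp (-(rG * (geo9K i).dist a a')))) :
    HasMajorant (g := toB6 (geo9K i) Rr' Hp) (fun p : SiteY i × ι => ιB (blkOf i.D.toDomains p.1))
      (Dl * conj b ((cutMulY (𝔸 := 𝔸) (bumpY i (ctrR i c) (3 * (SC i c : ℝ))) * B *
          ((1 - cutMulY (𝔸 := 𝔸) (fun z : SiteY i => if NearC i c (3 * SC i c) z.1 then (1 : ℝ) else 0)) * X) * B *
          cutMulY (𝔸 := 𝔸) (bumpY i (ctrR i c) (3 * (SC i c : ℝ)))).restrictScalars ℝ) * Dr)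
      (fun a a' : (geo9K i).Site => (if a ∈ S_L then (1 : ℝ) else 0) *
        (((κL * Real.exp (-(asep * (3 / 8 * (i.Mh : ℝ) - 1)))) * κG * CT * B6.c1 dB δ₀ β) *
          ((geo9K i).len a * ((geo9K i).len a ^ 3)⁻¹) * Real.exp (-(ρ * (geo9K i).dist a a')))) := by
  obtain ⟨htri, -, hdnn⟩ := geo9K_axioms i Rr' Hp
  set χl : SiteY i → ℝ := bumpY i (ctrR i c) (3 * (SC i c : ℝ)) with hχl
  set ind : SiteY i → ℝ := fun z => if NearC i c (3 * SC i c) z.1 then (1 : ℝ) else 0 with hind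
  rw [one_sub_cutMulY i ind]
  have e1 : ((cutMulY (𝔸 := 𝔸) χl * B * (cutMulY (𝔸 := 𝔸) (fun z => 1 - ind z) * X) * B * cutMulY (𝔸 := 𝔸) χl).restrictScalars ℝ
        : Module.End ℝ (SiteY i → 𝔸)) =
      (cutMulY (𝔸 := 𝔸) χl).restrictScalars ℝ * B.restrictScalars ℝ * ((cutMulY (𝔸 := 𝔸) (fun z => 1 - ind z)).restrictScalars ℝ * X.restrictScalars ℝ) *
        B.restrictScalars ℝ * (cutMulY (𝔸 := 𝔸) χl).restrictScalars ℝ := LinearMap.ext fun _ => rfl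
  rw [e1]
  simp only [B9Eq352DivFormLetters.conj_mul, conj_cutMulY]
  rw [show Dl * (mulOp (fun p : SiteY i × ι => χl p.1) * conj b (B.restrictScalars ℝ) *
        (mulOp (fun p : SiteY i × ι => 1 - ind p.1) * conj b (X.restrictScalars ℝ)) * conj b (B.restrictScalars ℝ) * mulOp (fun p : SiteY i × ι => χl p.1)) * Dr =
      (Dl * mulOp (fun p : SiteY i × ι => χl p.1) * conj b (B.restrictScalars ℝ)) * mulOp (fun p : SiteY i × ι => 1 - ind p.1) *
        (conj b (X.restrictScalars ℝ) * (conj b (B.restrictScalars ℝ) * mulOp (fun p : SiteY i × ι => χl p.1) * Dr)) from by simp only [mul_assoc]]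
  have hsep : ∀ a ∈ S_L,
      ∀ y ∈ (Finset.univ.filter fun a : IBondY i => ∃ z : SiteY i, ιB (blkOf i.D.toDomains z) = a ∧ ¬ NearC i c (3 * SC i c) z.1),
        3 / 8 * (i.Mh : ℝ) - 1 ≤ (geo9K i).dist a y := fun a ha y hy => by
    obtain ⟨z, rfl, hz⟩ := hSL a ha
    obtain ⟨w, rfl, hw⟩ := (Finset.mem_filter.1 hy).2
    exact collar_le_dist_chiL_notNear i c ιB hι hz hw
  have hw1 : ∀ a : IBondY i, 0 ≤ (geo9K i).len a := fun a => (geo9K_len_pos i a).le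
  have hG' := (hasMajorantHom_iff (g := toB6 (geo9K i) Rr' Hp) _ _ _).1
    (hasMajorantHom_rate_mono (R := Rr') (H := Hp) _ _ κG (fun a => ((geo9K i).len a ^ 3)⁻¹) (ρ := ρ) hκG (fun a => by have := hw1 a; positivity)
      hrG hdnn ((hasMajorantHom_iff (g := toB6 (geo9K i) Rr' Hp) _ _ _).2 hG))
  have h := word_far_majorant_blk (Rg := Rr') (Hg := Hp) (fun p : SiteY i × ι => ιB (blkOf i.D.toDomains p.1)) dB S_L
    ((Finset.univ.filter fun a : IBondY i => ∃ z : SiteY i, ιB (blkOf i.D.toDomains z) = a ∧ ¬ NearC i c (3 * SC i c) z.1 :) : Finset (IBondY i))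
    (fun p : SiteY i × ι => 1 - ind p.1) (fun a => (geo9K i).len a) (fun a => ((geo9K i).len a ^ 3)⁻¹)
    hκL hκG hCT hw1 (fun a => by have := hw1 a; positivity) hρ hasep (show asep + (r₀ - asep) ≤ r₀ by linarith) hr hdnn htri hSTT h261
    (fun p => by simp only [hind]; split_ifs <;> simp)
    (fun p hp => Finset.mem_filter.2 ⟨@Finset.mem_univ _ (_) _, p.1, rfl, fun h1 => hp (by simp only [hind]; rw [if_pos h1, sub_self])⟩)
    hsep hL hG'
  exact h


omit [NormedAlgebra ℂ 𝔸] [CompleteSpace 𝔸] [Fintype ι] [Fintype (geo9K i).Site] [DecidableEq (geo9K i).Site] in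
/-- bookkeeping: a located kernel `𝟙·(K·w(a)·e^{−rd})` under a common one `K′·w′(a)·e^{−ρd}` (`K ≤ K′`, `w(a) = w′(a) ≥ 0`, `ρ ≤ r`, `d ≥ 0`).
[cite: Balaban1984PropagatorsII, (2.51) p.232, bookkeeping] -/
theorem toCommon {ind K K' w w' r ρ dd : ℝ} (hind1 : ind ≤ 1) (hK : 0 ≤ K) (hKK' : K ≤ K') (hw : w = w') (hw0 : 0 ≤ w')
    (hρ : ρ ≤ r) (hd : 0 ≤ dd) : ind * (K * w * Real.exp (-(r * dd))) ≤ K' * w' * Real.exp (-(ρ * dd)) := by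
  rw [hw]
  have h1 : Real.exp (-(r * dd)) ≤ Real.exp (-(ρ * dd)) := Real.exp_le_exp.2 (by nlinarith)
  have h2 : K * w' * Real.exp (-(r * dd)) ≤ K' * w' * Real.exp (-(ρ * dd)) :=
    mul_le_mul (mul_le_mul_of_nonneg_right hKK' hw0) h1 (Real.exp_nonneg _) (mul_nonneg (hK.trans hKK') hw0)
  have h0 : 0 ≤ K * w' * Real.exp (-(r * dd)) := mul_nonneg (mul_nonneg hK hw0) (Real.exp_nonneg _)
  calc ind * (K * w' * Real.exp (-(r * dd))) ≤ 1 * (K * w' * Real.exp (-(r * dd))) := mul_le_mul_of_nonneg_right hind1 h0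
    _ ≤ _ := by rw [one_mul]; exact h2


open Classical in
set_option maxHeartbeats 3200000 in
/-- ★★★ **THE LOCATED `C`-DIFFERENCE SITE WORD OF `hP3` AT THE LETTERS**: for cut-offs `M_l = M_{χl_□}`, `M₂ = M_{𝟙[NearC 3S_j]}`, the commutator letter `R_χ(V′)`,
abstract letters `B, S, S_□, A, P, P_□` with scalars `e·e·σ = 1` (`e = η²`, `σ = η⁻⁴`) and FILE 2's four-word identity `h4` for `M₂(S − S_□)M₂`, the displayed member-carrier
majorants of the normalised letters and tails (left entry `D_lM_l(eB)` located in `S_L ⊆ NearC(21S_j∕8 + 1)`-blocks) give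
`D_l·conj((M_l·(B(S − S_□)B)·M_l)^ℝ)·D_r ≺ ε_{P3}·ℓ(a)⁻²·e^{−ρd}`, `ρ = r₀ − 5ε − a_sep`, `ε_{P3} = K₁ + ⋯ + K₈` explicit, each `K_k` carrying `e^{−a_sep(3M_h∕8 − 2)}` or
`e^{−a_sep(3M_h∕8 − 1)}` (p38 `sandwich_split` + FILE 2 split → §1 eight words → §3 word majorants → common kernel).
[cite: Balaban1985BackgroundPropagators, p.415 l.26–37, p.412 l.1–9 + l.22–36, (3.95) p.411, (3.48)–(3.49) pp.398–399; Balaban1983RegularityDecay, (1.11)–(1.12) (statement type); Balaban1984PropagatorsII, (2.83)–(2.85) pp.237–238, (2.52)–(2.61) pp.232–234] -/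
theorem hasMajorant_siteWord_of_letters (ιB : BlkY i → IBondY i) (hι : ∀ s, β i.hN i.D i.hk (ιB s) = s) (V' : CfgY 𝔸 i)
    (S_L : Finset (geo9K i).Site) (hSL : ∀ a ∈ S_L, ∃ z : SiteY i, ιB (blkOf i.D.toDomains z) = a ∧ NearC i c (21 * SC i c / 8 + 1) z.1)
    (Dl Dr : Module.End ℝ (SiteY i × ι → ℝ)) (B S Sb A P Pb : Module.End ℂ (SiteY i → 𝔸)) {e σ : ℂ} (hσ : e * e * σ = 1)
    (h4 : cutMulY (𝔸 := 𝔸) (fun z : SiteY i => if NearC i c (3 * SC i c) z.1 then (1 : ℝ) else 0) * (S - Sb) *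
        cutMulY (𝔸 := 𝔸) (fun z : SiteY i => if NearC i c (3 * SC i c) z.1 then (1 : ℝ) else 0) =
      cutMulY (𝔸 := 𝔸) (fun z : SiteY i => if NearC i c (3 * SC i c) z.1 then (1 : ℝ) else 0) * S * Pb * (1 - cutMulY (𝔸 := 𝔸) (chiY i c)) * (B * B) * Sb *
          cutMulY (𝔸 := 𝔸) (fun z : SiteY i => if NearC i c (3 * SC i c) z.1 then (1 : ℝ) else 0) -
        cutMulY (𝔸 := 𝔸) (fun z : SiteY i => if NearC i c (3 * SC i c) z.1 then (1 : ℝ) else 0) * S * (A * A) * (1 - cutMulY (𝔸 := 𝔸) (chiY i c)) * P * Sb *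
          cutMulY (𝔸 := 𝔸) (fun z : SiteY i => if NearC i c (3 * SC i c) z.1 then (1 : ℝ) else 0) -
        cutMulY (𝔸 := 𝔸) (fun z : SiteY i => if NearC i c (3 * SC i c) z.1 then (1 : ℝ) else 0) * S * (A * A) *
          ((cutMulY (𝔸 := 𝔸) (chiY i c) * deltaPrimeACubeY i c (parSymY i) V' - deltaPrimeACubeY i c (parSymY i) V' * cutMulY (𝔸 := 𝔸) (chiY i c)) *
            GpCubeY i c (parSymY i) V') * Sb *
          cutMulY (𝔸 := 𝔸) (fun z : SiteY i => if NearC i c (3 * SC i c) z.1 then (1 : ℝ) else 0) -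
        cutMulY (𝔸 := 𝔸) (fun z : SiteY i => if NearC i c (3 * SC i c) z.1 then (1 : ℝ) else 0) * S * A *
          ((cutMulY (𝔸 := 𝔸) (chiY i c) * deltaPrimeACubeY i c (parSymY i) V' - deltaPrimeACubeY i c (parSymY i) V' * cutMulY (𝔸 := 𝔸) (chiY i c)) *
            GpCubeY i c (parSymY i) V') * B * Sb *
          cutMulY (𝔸 := 𝔸) (fun z : SiteY i => if NearC i c (3 * SC i c) z.1 then (1 : ℝ) else 0))
    (dB : ℕ) {κL κS κA θ κP κPb κT0 κT1 κT2 κSb κR κG r₀ rS rA rc rT0 rT1 rT2 rSb rR rG δ₀ α β asep CS CA CT3 CT1 C1 : ℝ}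
    (hκL : 0 ≤ κL) (hκS : 0 ≤ κS) (hκA : 0 ≤ κA) (hθ : 0 ≤ θ) (hκP : 0 ≤ κP) (hκPb : 0 ≤ κPb) (hκT0 : 0 ≤ κT0) (hκT1 : 0 ≤ κT1) (hκT2 : 0 ≤ κT2)
    (hκSb : 0 ≤ κSb) (hκR : 0 ≤ κR) (hκG : 0 ≤ κG) (hCS : 0 ≤ CS) (hCA : 0 ≤ CA) (hCT3 : 0 ≤ CT3) (hCT1 : 0 ≤ CT1) (hC1 : 0 ≤ C1)
    (hαδ : 0 ≤ α * δ₀) (hε0 : 0 ≤ (α + β) * δ₀) (hasep : 0 ≤ asep) (hρ : 0 ≤ r₀ - 5 * ((α + β) * δ₀) - asep)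
    (hrS : r₀ - (α + β) * δ₀ ≤ rS) (hrA : r₀ - 2 * ((α + β) * δ₀) ≤ rA) (hrc : r₀ - 3 * ((α + β) * δ₀) - asep ≤ rc)
    (hrT0 : r₀ - 4 * ((α + β) * δ₀) - asep ≤ rT0) (hrT1 : r₀ - 4 * ((α + β) * δ₀) - asep ≤ rT1) (hrT2 : r₀ - 2 * ((α + β) * δ₀) - asep ≤ rT2)
    (hrSb : r₀ - (α + β) * δ₀ ≤ rSb) (hrR : r₀ - 2 * ((α + β) * δ₀) - asep ≤ rR) (hrG : r₀ - 5 * ((α + β) * δ₀) - asep ≤ rG)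
    (hST4 : ScaleTransfer (geo9K i) δ₀ α CS (fun a => ((geo9K i).len a ^ 4)⁻¹)) (hST2 : ScaleTransfer (geo9K i) δ₀ α CA (fun a => (geo9K i).len a ^ 2))
    (hST3 : ScaleTransfer (geo9K i) δ₀ α CT3 (fun a => ((geo9K i).len a ^ 3)⁻¹)) (hSTm1 : ScaleTransfer (geo9K i) δ₀ α CT1 (fun a => ((geo9K i).len a)⁻¹))
    (hST1 : ScaleTransfer (geo9K i) δ₀ α C1 (fun a => (geo9K i).len a)) (h261 : Ineq261 dB (toB6 (geo9K i) Rr' Hp) δ₀ β)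
    (hL : HasMajorant (g := toB6 (geo9K i) Rr' Hp) (fun p : SiteY i × ι => ιB (blkOf i.D.toDomains p.1))
      (Dl * mulOp (fun p : SiteY i × ι => bumpY i (ctrR i c) (3 * (SC i c : ℝ)) p.1) * conj b ((e • B).restrictScalars ℝ))
      (fun a a' : (geo9K i).Site => (if a ∈ S_L then (1 : ℝ) else 0) * (κL * (geo9K i).len a * Real.exp (-(r₀ * (geo9K i).dist a a')))))
    (hS : HasMajorant (g := toB6 (geo9K i) Rr' Hp) (fun p : SiteY i × ι => ιB (blkOf i.D.toDomains p.1)) (conj b ((σ • S).restrictScalars ℝ))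
      (fun a a' => κS * ((geo9K i).len a ^ 4)⁻¹ * Real.exp (-(rS * (geo9K i).dist a a'))))
    (hA : HasMajorant (g := toB6 (geo9K i) Rr' Hp) (fun p : SiteY i × ι => ιB (blkOf i.D.toDomains p.1)) (conj b ((e • A).restrictScalars ℝ))
      (fun a a' => κA * (geo9K i).len a ^ 2 * Real.exp (-(rA * (geo9K i).dist a a'))))
    (hRc : HasMajorant (g := toB6 (geo9K i) Rr' Hp) (fun p : SiteY i × ι => ιB (blkOf i.D.toDomains p.1))
      (conj b (((cutMulY (𝔸 := 𝔸) (chiY i c) * deltaPrimeACubeY i c (parSymY i) V' - deltaPrimeACubeY i c (parSymY i) V' * cutMulY (𝔸 := 𝔸) (chiY i c)) *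
        GpCubeY i c (parSymY i) V').restrictScalars ℝ))
      (fun a a' => θ * Real.exp (-(rc * (geo9K i).dist a a'))))
    (hP : HasMajorant (g := toB6 (geo9K i) Rr' Hp) (fun p : SiteY i × ι => ιB (blkOf i.D.toDomains p.1)) (conj b (P.restrictScalars ℝ))
      (fun a a' : (geo9K i).Site => if a = a' then κP else 0))
    (hPb : HasMajorant (g := toB6 (geo9K i) Rr' Hp) (fun p : SiteY i × ι => ιB (blkOf i.D.toDomains p.1)) (conj b (Pb.restrictScalars ℝ))
      (fun a a' : (geo9K i).Site => if a = a' then κPb else 0))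
    (hTail0 : HasMajorant (g := toB6 (geo9K i) Rr' Hp) (fun p : SiteY i × ι => ιB (blkOf i.D.toDomains p.1))
      (conj b ((σ • Sb).restrictScalars ℝ) * mulOp (fun p : SiteY i × ι => if NearC i c (3 * SC i c) p.1.1 then (1 : ℝ) else 0) *
        (conj b ((e • B).restrictScalars ℝ) * mulOp (fun p : SiteY i × ι => bumpY i (ctrR i c) (3 * (SC i c : ℝ)) p.1) * Dr))
      (fun a a' => κT0 * ((geo9K i).len a ^ 3)⁻¹ * Real.exp (-(rT0 * (geo9K i).dist a a'))))
    (hTail1 : HasMajorant (g := toB6 (geo9K i) Rr' Hp) (fun p : SiteY i × ι => ιB (blkOf i.D.toDomains p.1))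
      (conj b ((e • B).restrictScalars ℝ) * (conj b ((σ • Sb).restrictScalars ℝ) * mulOp (fun p : SiteY i × ι => if NearC i c (3 * SC i c) p.1.1 then (1 : ℝ) else 0) *
        (conj b ((e • B).restrictScalars ℝ) * mulOp (fun p : SiteY i × ι => bumpY i (ctrR i c) (3 * (SC i c : ℝ)) p.1) * Dr)))
      (fun a a' => κT1 * ((geo9K i).len a)⁻¹ * Real.exp (-(rT1 * (geo9K i).dist a a'))))
    (hTail2 : HasMajorant (g := toB6 (geo9K i) Rr' Hp) (fun p : SiteY i × ι => ιB (blkOf i.D.toDomains p.1))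
      (conj b ((e • B).restrictScalars ℝ) * conj b ((e • B).restrictScalars ℝ) *
        (conj b ((σ • Sb).restrictScalars ℝ) * mulOp (fun p : SiteY i × ι => if NearC i c (3 * SC i c) p.1.1 then (1 : ℝ) else 0) *
          (conj b ((e • B).restrictScalars ℝ) * mulOp (fun p : SiteY i × ι => bumpY i (ctrR i c) (3 * (SC i c : ℝ)) p.1) * Dr)))
      (fun a a' => κT2 * (geo9K i).len a * Real.exp (-(rT2 * (geo9K i).dist a a'))))
    (hSbL : HasMajorant (g := toB6 (geo9K i) Rr' Hp) (fun p : SiteY i × ι => ιB (blkOf i.D.toDomains p.1))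
      (mulOp (fun p : SiteY i × ι => if NearC i c (3 * SC i c) p.1.1 then (1 : ℝ) else 0) * conj b ((σ • Sb).restrictScalars ℝ))
      (fun a a' => κSb * ((geo9K i).len a ^ 4)⁻¹ * Real.exp (-(rSb * (geo9K i).dist a a'))))
    (hRop : HasMajorant (g := toB6 (geo9K i) Rr' Hp) (fun p : SiteY i × ι => ιB (blkOf i.D.toDomains p.1))
      (conj b ((e • B).restrictScalars ℝ) * mulOp (fun p : SiteY i × ι => bumpY i (ctrR i c) (3 * (SC i c : ℝ)) p.1) * Dr)
      (fun a a' => κR * (geo9K i).len a * Real.exp (-(rR * (geo9K i).dist a a'))))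
    (hG : HasMajorant (g := toB6 (geo9K i) Rr' Hp) (fun p : SiteY i × ι => ιB (blkOf i.D.toDomains p.1))
      (conj b ((σ • Sb).restrictScalars ℝ) * (conj b ((e • B).restrictScalars ℝ) * mulOp (fun p : SiteY i × ι => bumpY i (ctrR i c) (3 * (SC i c : ℝ)) p.1) * Dr))
      (fun a a' => κG * ((geo9K i).len a ^ 3)⁻¹ * Real.exp (-(rG * (geo9K i).dist a a')))) :
    HasMajorant (g := toB6 (geo9K i) Rr' Hp) (fun p : SiteY i × ι => ιB (blkOf i.D.toDomains p.1))
      (Dl * conj b ((cutMulY (𝔸 := 𝔸) (bumpY i (ctrR i c) (3 * (SC i c : ℝ))) * (B * (S - Sb) * B) *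
        cutMulY (𝔸 := 𝔸) (bumpY i (ctrR i c) (3 * (SC i c : ℝ)))).restrictScalars ℝ) * Dr)
      (fun a a' => (κL * κS * κPb * κT2 * (CS * C1) * B6.c1 dB δ₀ β ^ 2 * Real.exp (-(asep * (3 / 8 * (i.Mh : ℝ) - 1))) +
          κL * κS * κA ^ 2 * κP * κT0 * (CS * CA ^ 2 * CT3) * B6.c1 dB δ₀ β ^ 4 * Real.exp (-(asep * (3 / 8 * (i.Mh : ℝ) - 1))) +
          κL * κS * κA ^ 2 * θ * κT0 * (CS * CA ^ 2 * CT3) * B6.c1 dB δ₀ β ^ 5 * Real.exp (-(asep * (3 / 8 * (i.Mh : ℝ) - 2))) +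
          κL * κS * κA * θ * κT1 * (CS * CA * CT1) * B6.c1 dB δ₀ β ^ 4 * Real.exp (-(asep * (3 / 8 * (i.Mh : ℝ) - 2))) +
          κL * κS * κR * (CS * C1) * B6.c1 dB δ₀ β ^ 2 * Real.exp (-(asep * (3 / 8 * (i.Mh : ℝ) - 1))) +
          κL * κSb * κR * (CS * C1) * B6.c1 dB δ₀ β ^ 2 * Real.exp (-(asep * (3 / 8 * (i.Mh : ℝ) - 1))) +
          κL * Real.exp (-(asep * (3 / 8 * (i.Mh : ℝ) - 1))) * (κS * κR * C1 * B6.c1 dB δ₀ β) * CT3 * B6.c1 dB δ₀ β +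
          κL * Real.exp (-(asep * (3 / 8 * (i.Mh : ℝ) - 1))) * κG * CT3 * B6.c1 dB δ₀ β) *
        ((geo9K i).len a ^ 2)⁻¹ * Real.exp (-((r₀ - 5 * ((α + β) * δ₀) - asep) * (geo9K i).dist a a'))) := by
  obtain ⟨htri, -, hdnn⟩ := geo9K_axioms i Rr' Hp
  have hc1 : 0 ≤ B6.c1 dB δ₀ β := c1_nonneg _ _ _
  have hw1 : ∀ a : IBondY i, 0 < (geo9K i).len a := fun a => geo9K_len_pos i a
  set ε : ℝ := (α + β) * δ₀ with hε
  set ρ : ℝ := r₀ - 5 * ε - asep with hρdef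
  set χl : SiteY i → ℝ := bumpY i (ctrR i c) (3 * (SC i c : ℝ)) with hχl
  set ind : SiteY i → ℝ := fun z => if NearC i c (3 * SC i c) z.1 then (1 : ℝ) else 0 with hind
  set Rχ : Module.End ℂ (SiteY i → 𝔸) :=
    (cutMulY (𝔸 := 𝔸) (chiY i c) * deltaPrimeACubeY i c (parSymY i) V' - deltaPrimeACubeY i c (parSymY i) V' * cutMulY (𝔸 := 𝔸) (chiY i c)) *
      GpCubeY i c (parSymY i) V' with hRχ
  set Ml : Module.End ℂ (SiteY i → 𝔸) := cutMulY (𝔸 := 𝔸) χl with hMl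
  set M₂ : Module.End ℂ (SiteY i → 𝔸) := cutMulY (𝔸 := 𝔸) ind with hM₂
  set F : Module.End ℂ (SiteY i → 𝔸) := 1 - cutMulY (𝔸 := 𝔸) (chiY i c) with hF
  -- §1: the eight signed words, normalised
  rw [siteWord_split Ml B S Sb M₂ _ _ _ _ h4, norm_word1 hσ Ml B M₂ S Pb F Sb, norm_word2 hσ Ml B M₂ S A F P Sb, norm_word3 hσ Ml B M₂ S A Rχ Sb,
    norm_word4 hσ Ml B M₂ S A Rχ Sb, (norm_leak hσ Ml B M₂ S).1, (norm_leak hσ Ml B M₂ Sb).1, (norm_leak hσ Ml B M₂ S).2, (norm_leak hσ Ml B M₂ Sb).2]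
  -- the eight word majorants (§3), at the normalised letters
  have h1 := hasMajorant_word1_at i c b (Rr' := Rr') (Hp := Hp) ιB hι S_L hSL Dl Dr (e • B) (σ • S) Pb (σ • Sb) dB hκL hκS hκPb hκT2 hCS hC1
    hε0 hasep (by linarith) hrS hrT2 hST4 hST1 h261 hL hS hPb hTail2
  have h2 := hasMajorant_word2_at i c b (Rr' := Rr') (Hp := Hp) ιB hι S_L hSL Dl Dr (e • B) (σ • S) (e • A) P (σ • Sb) dB hκL hκS hκA hκP hκT0 hCS hCA hCT3
    hε0 hasep (by linarith) hrS hrA hrT0 hST4 hST2 hST3 h261 hL hS hA hP hTail0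
  have h3 := hasMajorant_word3_at i c b (Rr' := Rr') (Hp := Hp) ιB hι V' S_L hSL Dl Dr (e • B) (σ • S) (e • A) (σ • Sb) dB hκL hκS hκA hθ hκT0 hCS hCA hCT3
    hαδ hε0 hasep hρ hrS hrA (by linarith) (by linarith) hST4 hST2 hST3 h261 hL hS hA hRc hTail0
  have h4w := hasMajorant_word4_at i c b (Rr' := Rr') (Hp := Hp) ιB hι V' S_L hSL Dl Dr (e • B) (σ • S) (e • A) (σ • Sb) dB hκL hκS hκA hθ hκT1 hCS hCA hCT1
    hαδ hε0 hasep (by linarith) hrS hrA hrc hrT1 hST4 hST2 hSTm1 h261 hL hS hA hRc hTail1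
  -- the member `S` with near rows (`|M₂| ≤ 1`)
  have hSL' : HasMajorant (g := toB6 (geo9K i) Rr' Hp) (fun p : SiteY i × ι => ιB (blkOf i.D.toDomains p.1))
      (mulOp (fun p : SiteY i × ι => ind p.1) * conj b ((σ • S).restrictScalars ℝ))
      (fun a a' => κS * ((geo9K i).len a ^ 4)⁻¹ * Real.exp (-(rS * (geo9K i).dist a a'))) :=
    hasMajorant_mulOp_left (G := toB6 (geo9K i) Rr' Hp) (fun p : SiteY i × ι => ιB (blkOf i.D.toDomains p.1)) hS (fun p : SiteY i × ι => ind p.1)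
      fun p => by simp only [hind]; split_ifs <;> simp
  have h5 := hasMajorant_leakA_at i c b (Rr' := Rr') (Hp := Hp) ιB hι S_L hSL Dl Dr (e • B) (σ • S) dB hκL hκS hκR hCS hC1 hε0 hasep (by linarith) hrS hrR
    hST4 hST1 h261 hL hSL' hRop
  have h6 := hasMajorant_leakA_at i c b (Rr' := Rr') (Hp := Hp) ιB hι S_L hSL Dl Dr (e • B) (σ • Sb) dB hκL hκSb hκR hCS hC1 hε0 hasep (by linarith) hrSb hrR
    hST4 hST1 h261 hL hSbL hRop
  -- the member tail `S·(BM_lD_r)` composed here ([4] (2.52)–(2.61))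
  have hRop' := (hasMajorantHom_iff (g := toB6 (geo9K i) Rr' Hp) _ _ _).1
    (hasMajorantHom_rate_mono (R := Rr') (H := Hp) _ _ κR (fun a => (geo9K i).len a) (ρ := ρ) hκR (fun a => (hw1 a).le) (by linarith) hdnn
      ((hasMajorantHom_iff (g := toB6 (geo9K i) Rr' Hp) _ _ _).2 hRop))
  have hGS := mul_decay_majorant_blk (Rg := Rr') (Hg := Hp) (fun p : SiteY i × ι => ιB (blkOf i.D.toDomains p.1)) dB
    (fun a => ((geo9K i).len a ^ 4)⁻¹) (fun a => (geo9K i).len a) hκS hκR hC1 (fun a => by have := (hw1 a).le; positivity) (fun a => (hw1 a).le)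
    (by linarith) (show ρ + (α + β) * δ₀ ≤ rS by linarith) hdnn htri hST1 h261 hS hRop'
  have hGS' : HasMajorant (g := toB6 (geo9K i) Rr' Hp) (fun p : SiteY i × ι => ιB (blkOf i.D.toDomains p.1))
      (conj b ((σ • S).restrictScalars ℝ) * (conj b ((e • B).restrictScalars ℝ) * mulOp (fun p : SiteY i × ι => χl p.1) * Dr))
      (fun a a' => (κS * κR * C1 * B6.c1 dB δ₀ β) * ((geo9K i).len a ^ 3)⁻¹ * Real.exp (-(ρ * (geo9K i).dist a a'))) := by
    refine hasMajorant_mono (g := toB6 (geo9K i) Rr' Hp) _ hGS fun a a' => le_of_eq ?_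
    have hl := (hw1 a).ne'
    have e3 : ((geo9K i).len a ^ 4)⁻¹ * (geo9K i).len a = ((geo9K i).len a ^ 3)⁻¹ := by field_simp
    show κS * κR * C1 * B6.c1 dB δ₀ β * (((geo9K i).len a ^ 4)⁻¹ * (geo9K i).len a) * Real.exp (-(ρ * (geo9K i).dist a a')) =
      κS * κR * C1 * B6.c1 dB δ₀ β * ((geo9K i).len a ^ 3)⁻¹ * Real.exp (-(ρ * (geo9K i).dist a a'))
    rw [e3]
  have h7 := hasMajorant_leakB_at i c b (Rr' := Rr') (Hp := Hp) ιB hι S_L hSL Dl Dr (e • B) (σ • S) dB hκL (by positivity) hCT3 hρ hasep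
    (show ρ + (α + β) * δ₀ ≤ r₀ - asep by linarith) le_rfl hST3 h261 hL hGS'
  have h8 := hasMajorant_leakB_at i c b (Rr' := Rr') (Hp := Hp) ιB hι S_L hSL Dl Dr (e • B) (σ • Sb) dB hκL hκG hCT3 hρ hasep
    (show ρ + (α + β) * δ₀ ≤ r₀ - asep by linarith) hrG hST3 h261 hL hG
  -- coordinates: `conj` of the signed sum, distributed (the eight words as atoms)
  set w₁ : Module.End ℂ (SiteY i → 𝔸) := Ml * (e • B) * (M₂ * (σ • S) * Pb * F * ((e • B) * (e • B)) * (σ • Sb) * M₂) * (e • B) * Ml with hw₁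
  set w₂ : Module.End ℂ (SiteY i → 𝔸) := Ml * (e • B) * (M₂ * (σ • S) * ((e • A) * (e • A)) * F * P * (σ • Sb) * M₂) * (e • B) * Ml with hw₂
  set w₃ : Module.End ℂ (SiteY i → 𝔸) := Ml * (e • B) * (M₂ * (σ • S) * ((e • A) * (e • A)) * Rχ * (σ • Sb) * M₂) * (e • B) * Ml with hw₃
  set w₄ : Module.End ℂ (SiteY i → 𝔸) := Ml * (e • B) * (M₂ * (σ • S) * (e • A) * Rχ * (e • B) * (σ • Sb) * M₂) * (e • B) * Ml with hw₄
  set w₅ : Module.End ℂ (SiteY i → 𝔸) := Ml * (e • B) * (M₂ * (σ • S) * (1 - M₂)) * (e • B) * Ml with hw₅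
  set w₆ : Module.End ℂ (SiteY i → 𝔸) := Ml * (e • B) * (M₂ * (σ • Sb) * (1 - M₂)) * (e • B) * Ml with hw₆
  set w₇ : Module.End ℂ (SiteY i → 𝔸) := Ml * (e • B) * ((1 - M₂) * (σ • S)) * (e • B) * Ml with hw₇
  set w₈ : Module.End ℂ (SiteY i → 𝔸) := Ml * (e • B) * ((1 - M₂) * (σ • Sb)) * (e • B) * Ml with hw₈
  have e2 : ((w₁ - w₂ - w₃ - w₄ + w₅ - w₆ + w₇ - w₈).restrictScalars ℝ : Module.End ℝ (SiteY i → 𝔸)) =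
      w₁.restrictScalars ℝ - w₂.restrictScalars ℝ - w₃.restrictScalars ℝ - w₄.restrictScalars ℝ + w₅.restrictScalars ℝ - w₆.restrictScalars ℝ +
        w₇.restrictScalars ℝ - w₈.restrictScalars ℝ := LinearMap.ext fun _ => rfl
  rw [e2]
  simp only [B9Eq352DivFormLetters.conj_sub, B9Thm39CinvTorusRegular.conj_add, mul_sub, sub_mul, mul_add, add_mul]
  -- every word under the common kernel
  have hK : ∀ {T : Module.End ℝ (SiteY i × ι → ℝ)} {K r : ℝ} {w : (geo9K i).Site → ℝ} (K' : ℝ), 0 ≤ K → K ≤ K' → ρ ≤ r →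
      (∀ a, w a = ((geo9K i).len a ^ 2)⁻¹) →
      HasMajorant (g := toB6 (geo9K i) Rr' Hp) (fun p : SiteY i × ι => ιB (blkOf i.D.toDomains p.1)) T
        (fun a a' : (geo9K i).Site => (if a ∈ S_L then (1 : ℝ) else 0) * (K * w a * Real.exp (-(r * (geo9K i).dist a a')))) →
      HasMajorant (g := toB6 (geo9K i) Rr' Hp) (fun p : SiteY i × ι => ιB (blkOf i.D.toDomains p.1)) T
        (fun a a' => K' * ((geo9K i).len a ^ 2)⁻¹ * Real.exp (-(ρ * (geo9K i).dist a a'))) := by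
    intro T K r w K' hK0 hKK' hr hw hT
    refine hasMajorant_mono (g := toB6 (geo9K i) Rr' Hp) _ hT fun a a' => ?_
    exact toCommon (by split_ifs <;> norm_num) hK0 hKK' (hw a) (by have := (hw1 a).le; positivity) hr (hdnn a a')
  have hw_1 : ∀ a : (geo9K i).Site, (geo9K i).len a * ((geo9K i).len a ^ 4)⁻¹ * (geo9K i).len a = ((geo9K i).len a ^ 2)⁻¹ := fun a => by
    have hl := (hw1 a).ne'; field_simp
  have hw_2 : ∀ a : (geo9K i).Site, (geo9K i).len a * ((geo9K i).len a ^ 4)⁻¹ * ((geo9K i).len a ^ 2) ^ 2 * ((geo9K i).len a ^ 3)⁻¹ = ((geo9K i).len a ^ 2)⁻¹ :=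
    fun a => by have hl := (hw1 a).ne'; field_simp
  have hw_4 : ∀ a : (geo9K i).Site, (geo9K i).len a * ((geo9K i).len a ^ 4)⁻¹ * (geo9K i).len a ^ 2 * ((geo9K i).len a)⁻¹ = ((geo9K i).len a ^ 2)⁻¹ :=
    fun a => by have hl := (hw1 a).ne'; field_simp
  have hw_7 : ∀ a : (geo9K i).Site, (geo9K i).len a * ((geo9K i).len a ^ 3)⁻¹ = ((geo9K i).len a ^ 2)⁻¹ := fun a => by
    have hl := (hw1 a).ne'; field_simp
  have g1 := hK _ (by positivity) le_rfl (by linarith) hw_1 h1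
  have g2 := hK _ (by positivity) le_rfl (by linarith) hw_2 h2
  have g3 := hK _ (by positivity) le_rfl (by linarith) hw_2 h3
  have g4 := hK _ (by positivity) le_rfl (by linarith) hw_4 h4w
  have g5 := hK _ (by positivity) le_rfl (by linarith) hw_1 h5
  have g6 := hK _ (by positivity) le_rfl (by linarith) hw_1 h6
  have g7 := hK _ (by positivity) le_rfl le_rfl hw_7 h7
  have g8 := hK _ (by positivity) le_rfl le_rfl hw_7 h8
  refine hasMajorant_mono (g := toB6 (geo9K i) Rr' Hp) _
    (B6DomainMajorant.hasMajorant_sub _ (hasMajorant_add _ (B6DomainMajorant.hasMajorant_sub _ (hasMajorant_add _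
      (B6DomainMajorant.hasMajorant_sub _ (B6DomainMajorant.hasMajorant_sub _ (B6DomainMajorant.hasMajorant_sub _ g1 g2) g3) g4) g5) g6) g7) g8)
    fun a a' => le_of_eq ?_
  ring_nf

end Words

end Literature.MathematicalPhysics.QuantumFieldTheory.Balaban1983to89.B9Eq3105FamThreeLocCDiffWordsAt
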